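import Mathlib
import Literature.MathematicalPhysics.QuantumFieldTheory.Balaban1983to89.T4DefectFluxForm
import Literature.MathematicalPhysics.QuantumFieldTheory.Balaban1983to89.B9Ineq349

/-!
# T⁴ programme, node NE3 (η-rate of the minimisers) — THE SLICE HYPOTHESES `hg` FROM PER-LEVEL OPERATOR DATA
# of printed type: block-averaging masses, cube-localised propagator bounds, and the block count, kernel-checked

Ninth-generation leaf of the NE3 prover lineage P1 (technique: implicit-function / fixed-point structure of the
one-step constrained variational problem, Bałaban CMP 102 (1985) 277–309 = "B11", Sect. E, read since generation 5
as the DISCRETE implicit-function theorem = STABILITY × CONSISTENCY).  A NEW LEAF: it imports `T4DefectFluxForm`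
(hence `T4SliceTelescoping`: `sliceKernel`, `sandwich_pointwise`, `weightedRow_of_localised`,
`slice_bound_of_operatorData(₂)`, `consistencyT2_of_slices`, `faceKernel_of_slices`, `ne3Shape_of_slices_rpow`) and the
literature seats' `B9Ineq349` (hence `B9`: the TYPED printed statements `B9.Ineq342_346_347`, `B9.Ineq349`,
`B9.Thm31Printed`, `B9.Thm33Printed`, and `B9FromB6.pref4_nonneg`) and touches nothing in either.

## The point (MODEL mathematics: finite sums, matrices, real arithmetic; the dictionary is stated, never asserted)

Since generation 6 the (115)-currency wall of NE3 rests, on the stability side, on ONE family of hypotheses of printed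
TYPE: the per-level SLICE BOUNDS
  `hg : ∀ k, ∀ V ∈ dom, ∀ i < k + 1, ∀ x y, |g k V i x y| ≤ C·e^{−δρ_k(x,y)/L^i}/(L^i)^{d−1}`
of `T4SliceTelescoping.consistencyT2_of_slices` (gradient kernel; and the `(L^i)^d` version of
`T4DefectFluxForm.faceKernel_of_slices` for the second-difference kernel), `C, δ` UNIFORM in the level `k` and the
slice `i` — the STUCK GOAL of the lineage's records (`t4/T4-EST-U1b-OSC.md` §6) and of the gen-8 work list
`t4/b2b-balaban-t4-ne3-p1/g8/TYPING-SPEC.md` (item T7).  `T4SliceTelescoping.slice_bound_of_operatorData` already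
reduces ONE slice to operator data (A_j)/(B_j)/(P_j) at the scale `L^{j+1}`, but leaves to the reader (a) the
uniformity bookkeeping across slices and levels, (b) the transport of the row bound of `G⁽ʲ⁾` from its NATURAL scale
`L^j` to `L^{j+1}`, (c) slice `0`, (d) the block-projection bound (P_j) itself, (e) the geometric block count `hK` of
`weightedRow_of_localised`, and (f) the junction with the tree's typed form of B9 Theorem 3.1.  This leaf does
(a)–(f), so that `hg` is no longer a free hypothesis of the NE3 chain:
 (1) §4 `sliceKernel_bound_of_opData`: from (A) weighted rows of `G j` at scale `L^j` `≤ C_A(L^j)²`, (P) weighted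
     pointwise `|K j − K (j+1)| ≤ C_P/(L^{j+1})^{d+2}` at scale `L^{j+1}`, (B) weighted columns of `G j·D` at scale `L^j`
     `≤ C_B·L^j` — ALL `j`, constants level-free — EVERY slice `sliceKernel G K D i` obeys King's (3.63) shape with the
     uniform constant `C_B(1 + C_A·C_P)` (`L ≥ 1`; slice `0` from (B) at level `0` alone; scale transport by
     `weightedSum_mono_scale`).  `sliceKernel₂_bound_of_opData`: the same for the second-difference slices
     `sliceKernel₂ G K D₁ D₂` (exponent `d`; extra input (D): the outer difference is local at unit scale), with
     `sum_sliceKernel₂` = the telescoping identity `Σ_{i≤k} slices = D₁G_kD₂`.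
 (2) §2 (P_j), MASS PART, PROVED [model]: the level mass `a_jQ_j*Q_j` in lattice units is the block-local kernel
     `massKernel blk τ (a/(L^j)^{d+2})` (`|τ| ≤ 1` a majorant of the unitary transporters of B7's covariant averages);
     two NESTED levels differ by a coarse-block-local kernel of size `≤ m_j + m_{j+1}` (`abs_massKernel_sub_le`, no
     cancellation), whence `|(M_j − M_{j+1}) z w|·e^{δρ/L^{j+1}} ≤ a(L^{d+2} + 1)e^{δc}/(L^{j+1})^{d+2}`
     (`massDiff_weighted_scaled`) — the printed-type prefactor `(L^jη)^{−(d+2)}` of reading (I″), here a theorem about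
     the model.  GAUGE-FIXING PART: `pointwise_item3_of_349` reads the tree's typed (3.49) (`B9.Ineq349`, item `DPD*`)
     through an entry-domination dictionary (`EntryDominated`) as `|P z w| ≤ C·s^{−(d+2)}e^{−(δ₀/2)d}`, and
     `pointwise_weighted_of_expLocal` / `pointwise_weighted_sub` turn two such levels into (P) (sum of the two bounds).
 (3) §3 the GEOMETRIC BLOCK COUNT, PROVED: shells of `≤ A′(r+1)^p` blocks at integer block distance `r` give
     `Σ_b e^{−κ·bd b} ≤ A′·countConst κ p`, `countConst κ p = p!(2/κ)^p e^{κ/2}/(1 − e^{−κ/2})` (`blockCount_le`, from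
     `u^p/p! ≤ e^u` and a finite geometric sum); with `weightedRow_of_localised` this gives `weightedRow_of_cubeData`:
     cube-localised row data `Σ_{z∈b}|A x z| ≤ α₀e^{−δ₀·bd b}` + `ρ ≤ s·bd + c·s` + shell counts ⇒ the weighted row bound
     (A)/(B) with constant `α₀e^{δc}A′·countConst(δ₀ − δ)`.
 (4) §5 PRINTED TYPE BY NAME: `rowLocalised_of_342` — the tree's `B9.Ineq342_346_347 Gp B₀ δ₀ U` (B9 Thm 3.1's
     (3.42)/(3.46)/(3.47) at one configuration, a Prop of `B9.lean`, entering ONLY as a hypothesis) and the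
     row-observation dictionary `RowObservedBy` (the matrix relative of `B9Ineq349.ObservedBy`: test functions of sup
     norm `≤ 1` supported in one cube observe the row mass of the cube) give `Σ_{z∈y₁}|A x z| ≤
     B₀·pref4(len)_m·e^{−δ₀d(cube x, y₁)}`; `cubeData_of_342` puts it in the `hloc` form of (3) at one scale (`len ≤ s`,
     integer block distance `≤ d(·,·)`), items `m = 0` (`G`, prefactor `s²`: (A)) and `m = 1` (`∇_UG`, prefactor `s`:
     (A′), and (B) for the transpose — `colLocalised_of_transpose`).
 (5) §6 JUNCTIONS BY NAME, `hg` DISCHARGED: `consistencyT2_of_opData` (clause (T2) `dl ≤ C_DL(1 + k log L)` with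
     `C_DL = 2C + A·C·K_δ(1 + log ℓ)`, `C = C_B(1 + C_A C_P)`), `faceKernel_of_opData` (the two kernel hypotheses of
     `T4DefectFluxForm.faceColumn_sum_le`), `ne3Shape_of_opData_rpow` (= `ne3Shape_of_slices_rpow` with `hg` replaced by
     (A)/(P)/(B); every other binder passed through by name) — the node's shape `T4EtaRateMin.NE3Shape` at rate `L^{−a}`.
 (6) v1.1 ADDITIVE — §5b/§6b THE LEVEL ASSEMBLED: `weightedRow_of_342` / `weightedCol_of_342` / `opDataA_of_342` /
     `opDataB_of_342` ((A_j) and (B_j) literally, from `B9.Ineq342_346_347` by name + `RowObservedBy` + geometry, constant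
     `printedCA = B₀e^{δc}A′·countConst(δ₀ − δ) p` LEVEL-FREE), `gauge_weighted_coarser` / `gauge_weighted_own` /
     `gaugeDiff_weighted_scaled` (the gauge part of (P_j) across two levels from `B9.Ineq349` by name + `EntryDominated` +
     the distance dictionary, `C₃(L^{d+2} + 1)e^{(δ₁/2)c}/(L^{j+1})^{d+2}`, no inter-level cancellation),
     `massDiff_weighted_scaled'` (level-dependent masses `a_j ≤ a`), `opDataP_of_parts`, and
     `sliceKernel_bound_of_printedType`: on one fine lattice, with level-`j` geometries, the ONLY analytic inputs
     `h342 : ∀ j, B9.Ineq342_346_347 (Gp j) B₀ δ₀ (U j)` and `h349 : ∀ j, B9.Ineq349 d (P j) C₃ δ₁ (U j)` (hypotheses of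
     printed type, level-free constants), the dictionaries `hobsA`/`hobsB`/`hdom`, the operator model
     `K j = massKernel (cube j) (τ j) (a_j/(L^j)^{d+2}) + Ng j` and nested-block geometry give King's (3.63) shape for
     EVERY slice with `C = printedCA·(1 + printedCA·printedCP)` — the per-level `hg` with nothing left to assemble.
What REMAINS free after this leaf (the located gap, restated one level lower — records `t4/T4-EST-U1b-OSC.md` v1.19
RESULT 26, `t4/T4-EST-NE3-P1.md` v2.17, GAPS G-ne3p1-33): per level `k`, background `V` and slice level `j ≤ k + 1`,
 (i)  `B9.Ineq342_346_347 (Gp k V j) B₀ δ₀ (U k V j)` with `B₀, δ₀` level-free — printed TYPE: B9 Thm 3.1 / Thm 3.3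
      (constants «dependent on d and L only» which «do not depend on the sequence {Ω_j}») READ for the auxiliary
      propagator `G⁽ʲ⁾` of the resolvent telescoping = the domain sequence stopping at level `j`, on a background in the
      level-`j` class (3.35) ⊇ the level-`k` class [reading (I′)]; a HYPOTHESIS with its thresholds (`M ≥ M₁`,
      `Mα₀ ≤ a₀`) and the class membership per level explicit — never discharged by citation here;
 (ii) the observation / domination dictionaries `RowObservedBy` (items 0, 1; for the column side the Hermiticity of
      `G_k(U)`) and `EntryDominated` — the unprinted "kernel form" of Theorem 3.1 (cell GAPS G-pv16-1, located);
 (iii) GEOMETRY [model]: cube maps, nesting of blocks, coarse-block `ρ`-diameters `≤ c·L^{j+1}`, `ρ ≤ s·bd + c·s`,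
      `bd ≤ d(·,·)`, shell counts — the object typing T1 of the TYPING-SPEC (finite tori with nested block structure);
 (iv) two-sided inverses `G j·K j = 1` ONLY for the identities `sum_sliceKernel(₂)` (the dictionary `Σ slices =
      ∇G_k∇*`), not for any bound.
No conditional of the cell (`BetaPertH`, (B), (B^μ)) is used or hidden in this file; they stay the explicit hypotheses
of the NE3 node upstream (`Readings`, `OneStepCorrectionRate`, `h1`–`h5`, `hpair` of `ne3Shape_of_opData_rpow`, passed
through verbatim).

## What is printed and located ([R] = quoted from the materialised OCR text of the held paper; the B9 block below is
## reproduced byte-for-byte from the header of `T4SliceTelescoping` v1.1, certified verbatim against the renders by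
## referee 2 pass 12 (C-t4r2-37) and by the XREAD C-t4lit2g6-1 (renders read as images); B7's definitions (14)–(15),
## (58)–(62), (64), (67), (70), (124) are quoted in the audited headers of `T4CovariantDefectAlgebra` (XREADs C-ref5-178,
## C-ref5-182, C-adv8-88, C-t4r3-39, C-t4r3-45) and enter here ONLY as the dictionary of `massKernel`)

* [R] B9 = Bałaban, *Propagators for lattice gauge theories in a background field*, CMP 99 (1985) 389–434
  (`paper:balaban1985-cmp99-background-propagators`).  p. 397 [p0009]: «Theorem 3.1. There exist positive constants
  M₁, δ₀, a₀, B₀ dependent on d and L only, a constant B₀(β) dependent on d, L and β, 0 ≤ β < 1 (B₀(β) → ∞ if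
  β → 1), such that for M ≥ M₁ and for an arbitrary configuration U satisfying the regularity condition (3.35) with
  Mα₀ ≤ a₀, the operator G′(U) (a = 1) satisfies the inequalities» (3.42)–(3.47) [(3.42), display as read on the
  render by the XREAD: sup bounds of the FOUR items `|(G′(U)λ)(x)|, |(∇_UG′(U)λ)(x)|, |(G′(U)∇*_Uλ)(x)|,
  |(Δ_UG′(U)λ)(x)|` by `B₀[(L^jη)², L^jη, L^jη, 1]e^{−δ₀d(y,y′)}|λ|` for `x ∈ Δ(y)`, `y ∈ Λ_j`, `supp λ ⊂ Δ(y′)`;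
  SHAPE only].  p. 399 [p0011]: «Let us stress
  that the constants in the formulations of both theorems do not depend on the sequence {Ω_j}, j = 0, 1,…,k, if the
  conditions (2.1), (2.2) are satisfied.» and «Theorem 3.3. Under the assumptions of Theorem 3.1, and with the constants
  described there, the operator G(U) (a = 1) satisfies the inequalities (3.42)–(3.47), with G′(U) replaced by G(U) and
  λ replaced by a function J defined at bonds of the lattice T_η or Ω₀, and with values in g.» [print: «of the
  lattice T_η, or Ω₀, and»]; ibid. (3.49) [display as read on the render by the XREAD, item (d)]: `[|P(x,x′)|,
  |(DP)_μ(x,x′)|, |(PD*)_ν(x,x′)|, |(DPD*)_{μν}(x,x′)|] ≤ O(1)[1, (L^jη)^{−1}, (L^jη)^{−1}, (L^jη)^{−2}](L^{j′}η)^{−d}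
  e^{−(1/2)δ₀d(y,y′)}` for `x ∈ Δ(y)`, `y ∈ Λ_j`, `x′ ∈ Δ(y′)`, `y′ ∈ Λ_{j′}`, followed by «We have also the
  corresponding bounds for Hölder norms of the kernel (DPD*)_{μν}(x, x′).» — so the `DPD*` item at `j′ = j` carries
  the prefactor `(L^jη)^{−(d+2)}` of reading (I″) IN PRINT, with decay rate `δ₀/2` in B9's weighted distance `d(y,y′)`
  («defined by (2.36) in [4]», p. 397); what remains of reading (I″): (i) `d(y,y′)` restricted to `Λ_j`-cubes ↔
  `ρ/L^j` of this file, (ii) `K_j − K_{j+1}` involves the projections of TWO sequences (stopping at `j` and at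
  `j+1`) and (3.49) bounds each, the difference by the SUM (no cancellation is needed for the size `π₀`).
  p. 396 [p0008], (3.35): «|A| < O(1)Mα₀(L^jη)^{−1}, |∇^ηA| < O(1)Mα₀(L^jη)^{−2} on □, where O(1)M is a size of □
  in T_{L^{−j}}» ⟦T_{L^{−j}} = the lattice of big blocks, i.e. the size of □ in T_η is O(1)ML^jη, as the print says
  six lines above⟧ — the regularity class is scale-indexed.
* The tree's typed forms used BY NAME (module `B9`, literature seats r1/b09/pv16; statements never re-typed here):
  `B9.Ineq342_346_347 K B₀ δ₀ U` [(3.42): `K.e n U λ y ≤ B₀·pref4(len y)_n·e^{−δ₀d(y,y′)}·|λ|` for `supp λ ⊂ Δ(y′)`,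
  `pref4 t = [t², t, t, 1]`], `B9.Ineq349 d P C δ₀ U` [(3.49): `P.ker n U y y′ ≤ C·pref4inv(len y)_n·(len y′)^{−d}·
  e^{−(δ₀/2)d(y,y′)}`, `pref4inv t = [1, t⁻¹, t⁻¹, t⁻²]`], `B9.Thm31Printed` / `B9.Thm33Printed` (the family statements
  with the printed thresholds, from which a user destructures (i) above), `B9Ineq349.ObservedBy` (the precedent of
  `RowObservedBy`).

Honest framing: finite-T⁴ ultraviolet bookkeeping about MINIMISERS (rung (B)+1 of the cell's ladder); no conditional
(`BetaPertH`, (B), (B^μ)) enters; nothing here bears on infinite volume, a mass gap, or the Clay problem; NE3 is NOT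
proved by this file — its value is a typed skeleton with the gap located at (i)–(iii) above.  ABSOLUTE RULE of the
cell kept: no internally-minted statement enters as a cited fact; B9's theorems enter only as HYPOTHESES of the tree's
typed shape, B7's definitions only as dictionary; the manuscripts under audit are not cited for any disputed step.
No `sorry`, no axioms beyond Mathlib's; finite-sum estimates and ring identities are [folklore]; every [model] /
reading sentence is dictionary, never a hypothesis discharged by citation.  Records: `t4/T4-EST-U1b-OSC.md` v1.19
(RESULT 26), `t4/T4-EST-NE3-P1.md` v2.17, GAPS G-ne3p1-33 / C-ne3p1-33 of the cell `pub-balaban`.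
-/

noncomputable section

open Finset Real

namespace Literature.MathematicalPhysics.QuantumFieldTheory.Balaban1983to89.T4SliceOperatorData

open Literature.MathematicalPhysics.QuantumFieldTheory.Balaban1983to89.T4SliceTelescoping
  (resolvent_telescope_mul sliceKernel sandwich_pointwise weightedRow_of_localised slice_bound_of_operatorData
   sliceConst consistencyT2_of_slices ne3Shape_of_slices_rpow)
open Literature.MathematicalPhysics.QuantumFieldTheory.Balaban1983to89.T4DefectFluxForm
  (slice_bound_of_operatorData₂ faceKernel_of_slices)
open Literature.MathematicalPhysics.QuantumFieldTheory.Balaban1983to89.T4EtaRateMin (Readings NE3Shape)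
open Literature.MathematicalPhysics.QuantumFieldTheory.Balaban1983to89.T4FixedPointResponse (OneStepCorrectionRate)

/-! ## §1  Weighted toolkit: monotonicity in the scale, pointwise bounds for local kernels -/
section Toolkit

variable {X : Type*}

/-- The exponential weight `e^{δr/s}` decreases as the scale `s` grows (`δ, r ≥ 0`). [folklore] -/
theorem weight_mono_scale {δ r s s' : ℝ} (hδ : 0 ≤ δ) (hr : 0 ≤ r) (hs : 0 < s) (hss' : s ≤ s') :
    Real.exp (δ * (r / s')) ≤ Real.exp (δ * (r / s)) :=
  Real.exp_le_exp.2 (mul_le_mul_of_nonneg_left (div_le_div_of_nonneg_left hr hs hss') hδ)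

/-- A weighted row (or column) bound at scale `s` implies the one at any coarser scale `s' ≥ s`. [folklore] -/
theorem weightedSum_mono_scale [Fintype X] (a r : X → ℝ) {δ s s' : ℝ} (hδ : 0 ≤ δ) (ha : ∀ z, 0 ≤ a z)
    (hr : ∀ z, 0 ≤ r z) (hs : 0 < s) (hss' : s ≤ s') :
    ∑ z, a z * Real.exp (δ * (r z / s')) ≤ ∑ z, a z * Real.exp (δ * (r z / s)) :=
  Finset.sum_le_sum fun z _ => mul_le_mul_of_nonneg_left (weight_mono_scale hδ (hr z) hs hss') (ha z)

/-- **Block-local kernel ⇒ weighted pointwise bound.**  A kernel supported on pairs in a common block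
(`blk z = blk w`), of size `≤ p₀` there, with blocks of `ρ`-diameter `≤ c·s`, satisfies
`|P z w|·e^{δρ(z,w)/s} ≤ p₀·e^{δc}`.  [model] the level mass `a_jQ_j*Q_j` (block averaging). [folklore] -/
theorem pointwise_weighted_of_blockLocal {B : Type*} [DecidableEq B] (blk : X → B) (P : Matrix X X ℝ) (ρ : X → X → ℝ)
    {δ s c p₀ : ℝ} (hδ : 0 ≤ δ) (hs : 0 < s) (hp₀ : 0 ≤ p₀)
    (hP : ∀ z w, |P z w| ≤ if blk z = blk w then p₀ else 0)
    (hdiam : ∀ z w, blk z = blk w → ρ z w ≤ c * s) :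
    ∀ z w, |P z w| * Real.exp (δ * (ρ z w / s)) ≤ p₀ * Real.exp (δ * c) := by
  intro z w
  by_cases h : blk z = blk w
  · have h1 : |P z w| ≤ p₀ := by simpa [h] using hP z w
    have h2 : Real.exp (δ * (ρ z w / s)) ≤ Real.exp (δ * c) := by
      refine Real.exp_le_exp.2 (mul_le_mul_of_nonneg_left ?_ hδ)
      rw [div_le_iff₀ hs]; exact hdiam z w h
    exact mul_le_mul h1 h2 (Real.exp_nonneg _) hp₀
  · have h1 : |P z w| ≤ 0 := by simpa [h] using hP z w
    have h0 : |P z w| = 0 := le_antisymm h1 (abs_nonneg _)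
    rw [h0, zero_mul]
    exact mul_nonneg hp₀ (Real.exp_nonneg _)

/-- **Exponentially localised kernel ⇒ weighted pointwise bound**: `|P z w| ≤ p₀e^{−δ′ρ/s}` with `δ ≤ δ′` gives
`|P z w|·e^{δρ/s} ≤ p₀`.  [model] the (3.49)-shape of the gauge-fixing kernels `DPD*`. [folklore] -/
theorem pointwise_weighted_of_expLocal (P : Matrix X X ℝ) (ρ : X → X → ℝ) {δ δ' s p₀ : ℝ}
    (hδδ' : δ ≤ δ') (hρ : ∀ z w, 0 ≤ ρ z w) (hs : 0 < s) (hp₀ : 0 ≤ p₀)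
    (hP : ∀ z w, |P z w| ≤ p₀ * Real.exp (-(δ' * (ρ z w / s)))) :
    ∀ z w, |P z w| * Real.exp (δ * (ρ z w / s)) ≤ p₀ := by
  intro z w
  have hr : 0 ≤ ρ z w / s := div_nonneg (hρ z w) hs.le
  have h1 : |P z w| * Real.exp (δ * (ρ z w / s))
      ≤ p₀ * Real.exp (-(δ' * (ρ z w / s))) * Real.exp (δ * (ρ z w / s)) :=
    mul_le_mul_of_nonneg_right (hP z w) (Real.exp_nonneg _)
  have h2 : Real.exp (-(δ' * (ρ z w / s))) * Real.exp (δ * (ρ z w / s)) ≤ 1 := by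
    rw [← Real.exp_add, Real.exp_le_one_iff]
    nlinarith
  calc |P z w| * Real.exp (δ * (ρ z w / s))
      ≤ p₀ * Real.exp (-(δ' * (ρ z w / s))) * Real.exp (δ * (ρ z w / s)) := h1
    _ = p₀ * (Real.exp (-(δ' * (ρ z w / s))) * Real.exp (δ * (ρ z w / s))) := mul_assoc _ _ _
    _ ≤ p₀ * 1 := mul_le_mul_of_nonneg_left h2 hp₀
    _ = p₀ := mul_one _

/-- Weighted pointwise bounds add under sums of kernels. [folklore] -/
theorem pointwise_weighted_add (P₁ P₂ : Matrix X X ℝ) (E : X → X → ℝ) {π₁ π₂ : ℝ}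
    (hE : ∀ z w, 0 ≤ E z w) (h₁ : ∀ z w, |P₁ z w| * E z w ≤ π₁) (h₂ : ∀ z w, |P₂ z w| * E z w ≤ π₂) :
    ∀ z w, |(P₁ + P₂) z w| * E z w ≤ π₁ + π₂ := by
  intro z w
  rw [Matrix.add_apply]
  calc |P₁ z w + P₂ z w| * E z w ≤ (|P₁ z w| + |P₂ z w|) * E z w :=
        mul_le_mul_of_nonneg_right (abs_add_le _ _) (hE z w)
    _ = |P₁ z w| * E z w + |P₂ z w| * E z w := add_mul _ _ _
    _ ≤ π₁ + π₂ := add_le_add (h₁ z w) (h₂ z w)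

/-- Weighted pointwise bounds add under differences of kernels (no cancellation is used). [folklore] -/
theorem pointwise_weighted_sub (P₁ P₂ : Matrix X X ℝ) (E : X → X → ℝ) {π₁ π₂ : ℝ}
    (hE : ∀ z w, 0 ≤ E z w) (h₁ : ∀ z w, |P₁ z w| * E z w ≤ π₁) (h₂ : ∀ z w, |P₂ z w| * E z w ≤ π₂) :
    ∀ z w, |(P₁ - P₂) z w| * E z w ≤ π₁ + π₂ := by
  have h₂' : ∀ z w, |(-P₂) z w| * E z w ≤ π₂ := fun z w => by rw [Matrix.neg_apply, abs_neg]; exact h₂ z w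
  simpa [sub_eq_add_neg] using pointwise_weighted_add P₁ (-P₂) E hE h₁ h₂'

/-- **Pointwise from a weighted column bound**: each term is at most the sum. [folklore] -/
theorem pointwise_of_weightedCol [Fintype X] (B : Matrix X X ℝ) (ρ : X → X → ℝ) {δ s β : ℝ}
    (hB : ∀ y, ∑ w, |B w y| * Real.exp (δ * (ρ w y / s)) ≤ β) :
    ∀ x y, |B x y| ≤ β * Real.exp (-(δ * (ρ x y / s))) := by
  intro x y
  have hle : |B x y| * Real.exp (δ * (ρ x y / s)) ≤ β :=
    le_trans (Finset.single_le_sum (f := fun w => |B w y| * Real.exp (δ * (ρ w y / s)))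
      (fun w _ => mul_nonneg (abs_nonneg _) (Real.exp_nonneg _)) (Finset.mem_univ x)) (hB y)
  have hE := Real.exp_pos (δ * (ρ x y / s))
  rw [← le_div_iff₀ hE] at hle
  calc |B x y| ≤ β / Real.exp (δ * (ρ x y / s)) := hle
    _ = β * Real.exp (-(δ * (ρ x y / s))) := by rw [Real.exp_neg, div_eq_mul_inv]

/-- **Pointwise from a weighted row bound.** [folklore] -/
theorem pointwise_of_weightedRow [Fintype X] (A : Matrix X X ℝ) (ρ : X → X → ℝ) {δ s α : ℝ}
    (hA : ∀ x, ∑ z, |A x z| * Real.exp (δ * (ρ x z / s)) ≤ α) :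
    ∀ x y, |A x y| ≤ α * Real.exp (-(δ * (ρ x y / s))) := by
  intro x y
  have h := pointwise_of_weightedCol (Matrix.transpose A) (fun a b => ρ b a)
    (fun x' => by simpa [Matrix.transpose_apply] using hA x') y x
  simpa [Matrix.transpose_apply] using h

end Toolkit

/-! ## §2  The level mass kernel: (P_j) PROVED from the definition of block averaging [model] -/
section MassKernel

variable {X B B' : Type*} [DecidableEq B] [DecidableEq B']

/-- The scalar model of the level-`j` AVERAGING MASS `a_j·Q_j*Q_j` in lattice units: a kernel supported on pairs
in a common `j`-block, `m·τ z w` there, with `|τ| ≤ 1` a majorant of the parallel transporters (unitary for B7's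
covariant averages (14)–(15)/(124)) and `m = a/(L^j)^{d+2}` (the mass `a·(L^j)^{−2}` times the block mean's
`(L^j)^{−d}`).  A definition over an abstract finite type; the dictionary is [model], never asserted. [folklore] -/
def massKernel (blk : X → B) (τ : X → X → ℝ) (m : ℝ) : Matrix X X ℝ :=
  fun z w => if blk z = blk w then m * τ z w else 0

/-- Entries of the mass kernel are at most `m` in a block and `0` across blocks (`|τ| ≤ 1`, `m ≥ 0`). [folklore] -/
theorem abs_massKernel_le (blk : X → B) (τ : X → X → ℝ) {m : ℝ} (hm : 0 ≤ m) (hτ : ∀ z w, |τ z w| ≤ 1)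
    (z w : X) : |massKernel blk τ m z w| ≤ if blk z = blk w then m else 0 := by
  unfold massKernel
  split_ifs with h
  · rw [abs_mul, abs_of_nonneg hm]
    calc m * |τ z w| ≤ m * 1 := mul_le_mul_of_nonneg_left (hτ z w) hm
      _ = m := mul_one m
  · simp

/-- **The difference of two NESTED level masses is coarse-block-local** with size `≤ m + m′` (fine blocks refine
coarse blocks: `blk z = blk w → blk′ z = blk′ w`).  No cancellation is used. [folklore] -/
theorem abs_massKernel_sub_le (blk : X → B) (blk' : X → B') (τ τ' : X → X → ℝ) {m m' : ℝ}
    (hm : 0 ≤ m) (hm' : 0 ≤ m') (hτ : ∀ z w, |τ z w| ≤ 1) (hτ' : ∀ z w, |τ' z w| ≤ 1)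
    (hnest : ∀ z w, blk z = blk w → blk' z = blk' w) (z w : X) :
    |(massKernel blk τ m - massKernel blk' τ' m') z w| ≤ if blk' z = blk' w then m + m' else 0 := by
  rw [Matrix.sub_apply]
  have h1 := abs_massKernel_le blk τ hm hτ z w
  have h2 := abs_massKernel_le blk' τ' hm' hτ' z w
  have htri : |massKernel blk τ m z w - massKernel blk' τ' m' z w|
      ≤ |massKernel blk τ m z w| + |massKernel blk' τ' m' z w| := by
    rw [sub_eq_add_neg]
    exact (abs_add_le _ _).trans (le_of_eq (by rw [abs_neg]))
  by_cases h' : blk' z = blk' w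
  · rw [if_pos h']
    rw [if_pos h'] at h2
    have h1' : |massKernel blk τ m z w| ≤ m := by
      refine h1.trans ?_
      split_ifs
      · exact le_rfl
      · exact hm
    linarith
  · have hb : ¬ blk z = blk w := fun hzw => h' (hnest z w hzw)
    rw [if_neg h']
    rw [if_neg hb] at h1
    rw [if_neg h'] at h2
    linarith

/-- **(P_j), mass part, at one scale**: the weighted pointwise bound of the mass difference at the COARSE scale `s`
(coarse blocks of `ρ`-diameter `≤ c·s`). [folklore] -/
theorem massDiff_weighted (blk : X → B) (blk' : X → B') (τ τ' : X → X → ℝ) (ρ : X → X → ℝ)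
    {m m' δ s c : ℝ} (hm : 0 ≤ m) (hm' : 0 ≤ m') (hτ : ∀ z w, |τ z w| ≤ 1) (hτ' : ∀ z w, |τ' z w| ≤ 1)
    (hnest : ∀ z w, blk z = blk w → blk' z = blk' w) (hδ : 0 ≤ δ) (hs : 0 < s)
    (hdiam : ∀ z w, blk' z = blk' w → ρ z w ≤ c * s) :
    ∀ z w, |(massKernel blk τ m - massKernel blk' τ' m') z w| * Real.exp (δ * (ρ z w / s))
      ≤ (m + m') * Real.exp (δ * c) :=
  pointwise_weighted_of_blockLocal blk' _ ρ hδ hs (add_nonneg hm hm')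
    (abs_massKernel_sub_le blk blk' τ τ' hm hm' hτ hτ' hnest) hdiam

/-- **(P_j), mass part, in the programme's normalisation**: fine level `j` (mass `a/(L^j)^{d+2}`), coarse level
`j + 1` (mass `a/(L^{j+1})^{d+2}`), weight at the coarse scale `L^{j+1}`:
`|(M_j − M_{j+1}) z w|·e^{δρ/L^{j+1}} ≤ a(L^{d+2} + 1)e^{δc}/(L^{j+1})^{d+2}` — the printed-type prefactor
`(L^jη)^{−(d+2)}` of reading (I″), here PROVED for the block-averaging model. [folklore] -/
theorem massDiff_weighted_scaled (blk : X → B) (blk' : X → B') (τ τ' : X → X → ℝ) (ρ : X → X → ℝ)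
    {a δ L c : ℝ} {d : ℕ} (j : ℕ) (ha : 0 ≤ a) (hL : 0 < L) (hτ : ∀ z w, |τ z w| ≤ 1)
    (hτ' : ∀ z w, |τ' z w| ≤ 1) (hnest : ∀ z w, blk z = blk w → blk' z = blk' w) (hδ : 0 ≤ δ)
    (hdiam : ∀ z w, blk' z = blk' w → ρ z w ≤ c * L ^ (j + 1)) :
    ∀ z w, |(massKernel blk τ (a / (L ^ j) ^ (d + 2)) - massKernel blk' τ' (a / (L ^ (j + 1)) ^ (d + 2))) z w|
        * Real.exp (δ * (ρ z w / L ^ (j + 1)))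
      ≤ a * (L ^ (d + 2) + 1) * Real.exp (δ * c) / (L ^ (j + 1)) ^ (d + 2) := by
  intro z w
  have hs : 0 < L ^ (j + 1) := pow_pos hL _
  have ht : 0 < L ^ j := pow_pos hL _
  have htd : 0 < (L ^ j) ^ (d + 2) := pow_pos ht _
  have hsd : 0 < (L ^ (j + 1)) ^ (d + 2) := pow_pos hs _
  have h := massDiff_weighted blk blk' τ τ' ρ (div_nonneg ha htd.le) (div_nonneg ha hsd.le) hτ hτ' hnest hδ hs
    hdiam z w
  have hpow : (L ^ (j + 1)) ^ (d + 2) = L ^ (d + 2) * (L ^ j) ^ (d + 2) := by ring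
  have hLp : L ^ (d + 2) ≠ 0 := pow_ne_zero _ hL.ne'
  have hm : a / (L ^ j) ^ (d + 2) = a * L ^ (d + 2) / (L ^ (j + 1)) ^ (d + 2) := by
    rw [hpow, mul_comm a (L ^ (d + 2)), mul_div_mul_left a ((L ^ j) ^ (d + 2)) hLp]
  calc _ ≤ (a / (L ^ j) ^ (d + 2) + a / (L ^ (j + 1)) ^ (d + 2)) * Real.exp (δ * c) := h
    _ = a * (L ^ (d + 2) + 1) * Real.exp (δ * c) / (L ^ (j + 1)) ^ (d + 2) := by
        rw [hm]
        ring

end MassKernel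

/-! ## §3  The geometric block count PROVED from shell counts; weighted rows from cube-localised data -/
section BlockCount

/-- The block-count constant `p!(2/κ)^p e^{κ/2}/(1 − e^{−κ/2})`: `Σ_r #{blocks at block distance r}·e^{−κr}` for
shells of size `≤ A′(r+1)^p`. [folklore] -/
def countConst (κ : ℝ) (p : ℕ) : ℝ :=
  p.factorial * (2 / κ) ^ p * Real.exp (κ / 2) / (1 - Real.exp (-(κ / 2)))

/-- The block-count constant is positive for `κ > 0`. [folklore] -/
theorem countConst_pos {κ : ℝ} (hκ : 0 < κ) (p : ℕ) : 0 < countConst κ p := by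
  unfold countConst
  have hq : Real.exp (-(κ / 2)) < 1 := Real.exp_lt_one_iff.2 (by linarith)
  have hfac : (0 : ℝ) < p.factorial := by exact_mod_cast p.factorial_pos
  have h2 : (0 : ℝ) < (2 / κ) ^ p := pow_pos (div_pos two_pos hκ) _
  exact div_pos (mul_pos (mul_pos hfac h2) (Real.exp_pos _)) (by linarith)

/-- Polynomial times exponential is dominated by a half-rate geometric sequence:
`(r+1)^p e^{−κr} ≤ p!(2/κ)^p e^{κ/2}·(e^{−κ/2})^r` (from `u^p/p! ≤ e^u`, `u = κ(r+1)/2`). [folklore] -/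
theorem pow_mul_exp_neg_le {κ : ℝ} (hκ : 0 < κ) (p r : ℕ) :
    ((r : ℝ) + 1) ^ p * Real.exp (-(κ * r))
      ≤ p.factorial * (2 / κ) ^ p * Real.exp (κ / 2) * Real.exp (-(κ / 2)) ^ r := by
  set u : ℝ := κ / 2 * ((r : ℝ) + 1) with hu
  have hu0 : 0 ≤ u := by positivity
  have hfac : (0 : ℝ) < p.factorial := by exact_mod_cast p.factorial_pos
  have h1 : u ^ p / p.factorial ≤ Real.exp u := Real.pow_div_factorial_le_exp u hu0 p
  have h1' : u ^ p ≤ p.factorial * Real.exp u := by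
    rw [div_le_iff₀ hfac] at h1
    linarith
  have hκ2 : (2 / κ) * (κ / 2) = 1 := by field_simp
  have h2 : ((r : ℝ) + 1) ^ p = (2 / κ) ^ p * u ^ p := by
    rw [hu, ← mul_pow, ← mul_assoc, hκ2, one_mul]
  have h3 : ((r : ℝ) + 1) ^ p ≤ (2 / κ) ^ p * (p.factorial * Real.exp u) := by
    rw [h2]
    exact mul_le_mul_of_nonneg_left h1' (pow_nonneg (div_nonneg zero_le_two hκ.le) _)
  have h4 : Real.exp u * Real.exp (-(κ * r)) = Real.exp (κ / 2) * Real.exp (-(κ / 2)) ^ r := by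
    rw [← Real.exp_nat_mul, ← Real.exp_add, ← Real.exp_add]
    congr 1
    rw [hu]
    ring
  calc ((r : ℝ) + 1) ^ p * Real.exp (-(κ * r))
      ≤ (2 / κ) ^ p * (p.factorial * Real.exp u) * Real.exp (-(κ * r)) :=
        mul_le_mul_of_nonneg_right h3 (Real.exp_nonneg _)
    _ = p.factorial * (2 / κ) ^ p * (Real.exp u * Real.exp (-(κ * r))) := by ring
    _ = p.factorial * (2 / κ) ^ p * (Real.exp (κ / 2) * Real.exp (-(κ / 2)) ^ r) := by rw [h4]
    _ = _ := by ring

/-- A finite geometric sum at ratio `e^{−κ/2}` is at most `1/(1 − e^{−κ/2})`. [folklore] -/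
theorem geom_halfRate_sum_le {κ : ℝ} (hκ : 0 < κ) (S : Finset ℕ) :
    ∑ r ∈ S, Real.exp (-(κ / 2)) ^ r ≤ 1 / (1 - Real.exp (-(κ / 2))) := by
  have hq0 : 0 ≤ Real.exp (-(κ / 2)) := Real.exp_nonneg _
  have hq1 : Real.exp (-(κ / 2)) < 1 := Real.exp_lt_one_iff.2 (by linarith)
  have hsub : S ⊆ Finset.range (S.sup id + 1) := by
    intro r hr
    have : r ≤ S.sup id := Finset.le_sup (f := id) hr
    exact Finset.mem_range.2 (Nat.lt_succ_of_le this)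
  calc ∑ r ∈ S, Real.exp (-(κ / 2)) ^ r ≤ ∑ r ∈ Finset.range (S.sup id + 1), Real.exp (-(κ / 2)) ^ r :=
        Finset.sum_le_sum_of_subset_of_nonneg hsub (fun r _ _ => pow_nonneg hq0 r)
    _ ≤ Real.exp (-(κ / 2)) ^ 0 / (1 - Real.exp (-(κ / 2))) := by
        rw [Finset.range_eq_Ico]
        exact geom_sum_Ico_le_of_lt_one hq0 hq1
    _ = 1 / (1 - Real.exp (-(κ / 2))) := by rw [pow_zero]

/-- **The geometric block count from shell counts.**  Blocks `b` carry an integer block distance `bd b` from the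
observation block; if at most `A′(r+1)^p` blocks sit at block distance `r`, then `Σ_b e^{−κ·bd b} ≤ A′·countConst κ p`.
[model] the `L^j`-blocks of the torus (shells `≤ A′(r+1)^{d−1}`), or of the face skeleton. [folklore] -/
theorem blockCount_le {B : Type*} [Fintype B] (bd : B → ℕ) {κ A' : ℝ} {p : ℕ} (hκ : 0 < κ) (hA' : 0 ≤ A')
    (hcount : ∀ r : ℕ, ((Finset.univ.filter fun b => bd b = r).card : ℝ) ≤ A' * ((r : ℝ) + 1) ^ p) :
    ∑ b, Real.exp (-(κ * bd b)) ≤ A' * countConst κ p := by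
  classical
  set M : ℝ := p.factorial * (2 / κ) ^ p * Real.exp (κ / 2) with hM
  have hM0 : 0 ≤ M := by rw [hM]; positivity
  have hmaps : ∀ b ∈ (Finset.univ : Finset B), bd b ∈ Finset.univ.image bd :=
    fun b _ => Finset.mem_image_of_mem _ (Finset.mem_univ _)
  have hfib := Finset.sum_fiberwise_of_maps_to' hmaps (fun r : ℕ => Real.exp (-(κ * (r : ℝ))))
  rw [← hfib]
  calc ∑ r ∈ Finset.univ.image bd, ∑ b ∈ Finset.univ.filter (fun b => bd b = r), Real.exp (-(κ * (r : ℝ)))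
      = ∑ r ∈ Finset.univ.image bd,
          ((Finset.univ.filter fun b => bd b = r).card : ℝ) * Real.exp (-(κ * (r : ℝ))) := by
        refine Finset.sum_congr rfl fun r _ => ?_
        rw [Finset.sum_const, nsmul_eq_mul]
    _ ≤ ∑ r ∈ Finset.univ.image bd, A' * ((r : ℝ) + 1) ^ p * Real.exp (-(κ * (r : ℝ))) :=
        Finset.sum_le_sum fun r _ => mul_le_mul_of_nonneg_right (hcount r) (Real.exp_nonneg _)
    _ ≤ ∑ r ∈ Finset.univ.image bd, A' * (M * Real.exp (-(κ / 2)) ^ r) :=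
        Finset.sum_le_sum fun r _ => by
          rw [mul_assoc]
          exact mul_le_mul_of_nonneg_left (pow_mul_exp_neg_le hκ p r) hA'
    _ = A' * M * ∑ r ∈ Finset.univ.image bd, Real.exp (-(κ / 2)) ^ r := by
        rw [Finset.mul_sum]
        refine Finset.sum_congr rfl fun r _ => ?_
        ring
    _ ≤ A' * M * (1 / (1 - Real.exp (-(κ / 2)))) :=
        mul_le_mul_of_nonneg_left (geom_halfRate_sum_le hκ _) (mul_nonneg hA' hM0)
    _ = A' * countConst κ p := by rw [hM]; unfold countConst; ring

/-- **Weighted row bound from cube-localised data and shell counts** (`weightedRow_of_localised` with the block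
count PROVED): `Σ_z a z·e^{δρ z/s} ≤ α₀e^{δc}·A′·countConst(δ₀ − δ)`. [folklore] -/
theorem weightedRow_of_cubeData {Y B : Type*} [Fintype Y] [Fintype B] [DecidableEq B] (blk : Y → B)
    (a : Y → ℝ) (ρ : Y → ℝ) (bd : B → ℕ) {δ₀ δ s c α₀ A' : ℝ} {p : ℕ} (hs : 0 < s) (hδ : 0 ≤ δ)
    (hδ₀ : δ < δ₀) (ha : ∀ z, 0 ≤ a z) (hα₀ : 0 ≤ α₀) (hA' : 0 ≤ A')
    (hloc : ∀ b, ∑ z ∈ Finset.univ.filter (fun z => blk z = b), a z ≤ α₀ * Real.exp (-(δ₀ * bd b)))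
    (hρ : ∀ z, ρ z ≤ s * bd (blk z) + c * s)
    (hcount : ∀ r : ℕ, ((Finset.univ.filter fun b => bd b = r).card : ℝ) ≤ A' * ((r : ℝ) + 1) ^ p) :
    ∑ z, a z * Real.exp (δ * (ρ z / s)) ≤ α₀ * Real.exp (δ * c) * (A' * countConst (δ₀ - δ) p) := by
  have hs0 : s ≠ 0 := hs.ne'
  refine weightedRow_of_localised blk a ρ (fun b => s * bd b) (δ₀ := δ₀) hs hδ ha ?_ ?_ ?_ hα₀
  · intro b
    simpa [mul_div_cancel_left₀ _ hs0] using hloc b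
  · intro z
    exact hρ z
  · have h := blockCount_le bd (sub_pos.2 hδ₀) hA' hcount
    simpa [mul_div_cancel_left₀ _ hs0] using h

end BlockCount

/-! ## §4  THE SLICE HYPOTHESES FROM PER-LEVEL OPERATOR DATA -/
section Assembly

variable {X : Type*} [Fintype X]

/-- **The `hg` binder of `T4SliceTelescoping.consistencyT2_of_slices` / `profile_of_slices` (exponent `d − 1`),
DISCHARGED from per-level operator data at the NATURAL scales** — constants `CA, CB, CP` uniform in the level:
 (A) weighted rows of `G j` at scale `L^j` are `≤ CA(L^j)²`;
 (P) the level difference `K j − K (j+1)` is weighted-pointwise `≤ CP/(L^{j+1})^{d+2}` at scale `L^{j+1}`;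
 (B) weighted columns of `G j·D` at scale `L^j` are `≤ CB·L^j`.
Then EVERY slice obeys King's (3.63) shape with the uniform constant `CB(1 + CA·CP)`:
slice `0` from (B) at level `0` alone, slice `j+1` by `slice_bound_of_operatorData` after moving (A) from scale `L^j`
to `L^{j+1}` (`L ≥ 1`).  Hypothesis SHAPES of printed TYPE per level (B9 Thm 3.1 (3.42) items 0–1 / Thm 3.3, read for
the family stopping at level `j` — reading (I′)); (P) is §2 [model] + (3.49); nothing of Bałaban's is asserted.
[folklore] -/
theorem sliceKernel_bound_of_opData (G K : ℕ → Matrix X X ℝ) (D : Matrix X X ℝ) (ρ : X → X → ℝ)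
    {δ L CA CB CP : ℝ} {d : ℕ} (hd : 1 ≤ d) (hL : 1 ≤ L) (hδ : 0 ≤ δ) (hCA : 0 ≤ CA) (hCB : 0 ≤ CB)
    (hCP : 0 ≤ CP) (hρ : ∀ x y, 0 ≤ ρ x y) (htri : ∀ x z w y, ρ x y ≤ ρ x z + ρ z w + ρ w y)
    (hA : ∀ j x, ∑ z, |G j x z| * Real.exp (δ * (ρ x z / L ^ j)) ≤ CA * (L ^ j) ^ 2)
    (hP : ∀ j z w, |(K j - K (j + 1)) z w| * Real.exp (δ * (ρ z w / L ^ (j + 1)))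
      ≤ CP / (L ^ (j + 1)) ^ (d + 2))
    (hB : ∀ j y, ∑ w, |(G j * D) w y| * Real.exp (δ * (ρ w y / L ^ j)) ≤ CB * L ^ j) :
    ∀ i x y, |sliceKernel G K D i x y|
      ≤ CB * (1 + CA * CP) * (Real.exp (-(δ * (ρ x y / L ^ i))) / (L ^ i) ^ (d - 1)) := by
  have hL0 : 0 < L := by linarith
  have hCC : CB ≤ CB * (1 + CA * CP) :=
    le_mul_of_one_le_right hCB (by nlinarith [mul_nonneg hCA hCP])
  have hCC' : CA * CB * CP ≤ CB * (1 + CA * CP) := by nlinarith [mul_nonneg hCA hCP]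
  intro i x y
  cases i with
  | zero =>
      have h0 := pointwise_of_weightedCol (G 0 * D) ρ (hB 0) x y
      have hE : 0 ≤ Real.exp (-(δ * (ρ x y / L ^ 0))) / (L ^ 0) ^ (d - 1) := by positivity
      calc |sliceKernel G K D 0 x y| = |(G 0 * D) x y| := by simp [sliceKernel]
        _ ≤ CB * L ^ 0 * Real.exp (-(δ * (ρ x y / L ^ 0))) := h0
        _ = CB * (Real.exp (-(δ * (ρ x y / L ^ 0))) / (L ^ 0) ^ (d - 1)) := by simp
        _ ≤ CB * (1 + CA * CP) * (Real.exp (-(δ * (ρ x y / L ^ 0))) / (L ^ 0) ^ (d - 1)) :=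
            mul_le_mul_of_nonneg_right hCC hE
  | succ j =>
      have hs : 0 < L ^ j := pow_pos hL0 _
      have hss : L ^ j ≤ L ^ (j + 1) := by
        rw [pow_succ]
        exact le_mul_of_one_le_right hs.le hL
      have hA' : ∀ x, ∑ z, |G j x z| * Real.exp (δ * (ρ x z / L ^ (j + 1))) ≤ CA * (L ^ (j + 1)) ^ 2 := by
        intro x
        calc ∑ z, |G j x z| * Real.exp (δ * (ρ x z / L ^ (j + 1)))
            ≤ ∑ z, |G j x z| * Real.exp (δ * (ρ x z / L ^ j)) :=
              weightedSum_mono_scale (fun z => |G j x z|) (fun z => ρ x z) hδ (fun z => abs_nonneg _)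
                (fun z => hρ x z) hs hss
          _ ≤ CA * (L ^ j) ^ 2 := hA j x
          _ ≤ CA * (L ^ (j + 1)) ^ 2 := mul_le_mul_of_nonneg_left (pow_le_pow_left₀ hs.le hss 2) hCA
      have h := slice_bound_of_operatorData (G j) (K j - K (j + 1)) (G (j + 1) * D) ρ j hd hL0 hδ hCA hCB htri
        hA' (hP j) (hB (j + 1)) le_rfl le_rfl le_rfl x y
      have hE : 0 ≤ Real.exp (-(δ * (ρ x y / L ^ (j + 1)))) / (L ^ (j + 1)) ^ (d - 1) := by positivity
      calc |sliceKernel G K D (j + 1) x y| = |(G j * (K j - K (j + 1)) * (G (j + 1) * D)) x y| := by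
            simp [sliceKernel]
        _ ≤ CA * CB * CP * (Real.exp (-(δ * (ρ x y / L ^ (j + 1)))) / (L ^ (j + 1)) ^ (d - 1)) := h
        _ ≤ CB * (1 + CA * CP) * (Real.exp (-(δ * (ρ x y / L ^ (j + 1)))) / (L ^ (j + 1)) ^ (d - 1)) :=
            mul_le_mul_of_nonneg_right hCC' hE

/-- The SECOND-DIFFERENCE slice kernels `∇G⁽ʲ⁾(K_j − K_{j+1})(G⁽ʲ⁺¹⁾∇*)` (a lattice difference on EACH outer factor):
slice `0` is `D₁G⁽⁰⁾D₂`, slice `j+1` is `(D₁G⁽ʲ⁾)(K_j − K_{j+1})(G⁽ʲ⁺¹⁾D₂)`.  [model] the slices of `∇G_f∇*`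
consumed by `T4DefectFluxForm.faceKernel_of_slices`. [folklore] -/
def sliceKernel₂ (G K : ℕ → Matrix X X ℝ) (D₁ D₂ : Matrix X X ℝ) : ℕ → X → X → ℝ
  | 0 => fun x y => (D₁ * G 0 * D₂) x y
  | j + 1 => fun x y => (D₁ * G j * (K j - K (j + 1)) * (G (j + 1) * D₂)) x y

/-- The `k + 1` second-difference slices sum to the entry of `D₁·G_k·D₂` (`resolvent_telescope_mul` left-multiplied
by `D₁`). [folklore] -/
theorem sum_sliceKernel₂ [DecidableEq X] (G K : ℕ → Matrix X X ℝ) (D₁ D₂ : Matrix X X ℝ)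
    (hl : ∀ j, G j * K j = 1) (hr : ∀ j, K j * G j = 1) (k : ℕ) (x y : X) :
    ∑ i ∈ Finset.range (k + 1), sliceKernel₂ G K D₁ D₂ i x y = (D₁ * G k * D₂) x y := by
  have h := resolvent_telescope_mul K G hl hr k D₂
  have h2 : D₁ * G k * D₂
      = D₁ * (G 0 * D₂) + ∑ j ∈ Finset.range k, D₁ * (G j * ((K j - K (j + 1)) * (G (j + 1) * D₂))) := by
    rw [Matrix.mul_assoc, h, Matrix.mul_add, Finset.mul_sum]
    simp only [Matrix.mul_assoc]
  rw [Finset.sum_range_succ', h2, Matrix.add_apply, Matrix.sum_apply]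
  simp only [sliceKernel₂, Matrix.mul_assoc]
  exact add_comm _ _

/-- **The `hg` binder of `T4DefectFluxForm.faceKernel_of_slices` (exponent `d`), DISCHARGED from per-level
operator data**: (A′) weighted rows of `D₁·G j` at scale `L^j` `≤ CA′·L^j` (B9 (3.42) item 1 type); (B) weighted
columns of `G j·D₂` `≤ CB·L^j`; (P) as before; (D) the outer difference `D₁` is local: weighted rows at unit scale
`≤ CD`, and `ρ z z = 0`.  Uniform constant `CD·CB + CA′·CB·CP`. [folklore] -/
theorem sliceKernel₂_bound_of_opData [DecidableEq X] (G K : ℕ → Matrix X X ℝ) (D₁ D₂ : Matrix X X ℝ) (ρ : X → X → ℝ)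
    {δ L CA' CB CP CD : ℝ} {d : ℕ} (hL : 1 ≤ L) (hδ : 0 ≤ δ) (hCA' : 0 ≤ CA') (hCB : 0 ≤ CB)
    (hCP : 0 ≤ CP) (hCD : 0 ≤ CD) (hρ : ∀ x y, 0 ≤ ρ x y) (hρ0 : ∀ z, ρ z z = 0)
    (htri : ∀ x z w y, ρ x y ≤ ρ x z + ρ z w + ρ w y)
    (hA' : ∀ j x, ∑ z, |(D₁ * G j) x z| * Real.exp (δ * (ρ x z / L ^ j)) ≤ CA' * L ^ j)
    (hP : ∀ j z w, |(K j - K (j + 1)) z w| * Real.exp (δ * (ρ z w / L ^ (j + 1)))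
      ≤ CP / (L ^ (j + 1)) ^ (d + 2))
    (hB : ∀ j y, ∑ w, |(G j * D₂) w y| * Real.exp (δ * (ρ w y / L ^ j)) ≤ CB * L ^ j)
    (hD : ∀ x, ∑ z, |D₁ x z| * Real.exp (δ * ρ x z) ≤ CD) :
    ∀ i x y, |sliceKernel₂ G K D₁ D₂ i x y|
      ≤ (CD * CB + CA' * CB * CP) * (Real.exp (-(δ * (ρ x y / L ^ i))) / (L ^ i) ^ d) := by
  have hL0 : 0 < L := by linarith
  have h1 : CD * CB ≤ CD * CB + CA' * CB * CP := by nlinarith [mul_nonneg (mul_nonneg hCA' hCB) hCP]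
  have h2 : CA' * CB * CP ≤ CD * CB + CA' * CB * CP := by nlinarith [mul_nonneg hCD hCB]
  intro i x y
  cases i with
  | zero =>
      -- slice 0 = D₁ · 1 · (G 0 D₂): sandwich at unit scale
      have hDu : ∀ x, ∑ z, |D₁ x z| * Real.exp (δ * (ρ x z / 1)) ≤ CD := fun x => by
        simpa using hD x
      have hone : ∀ z w, |(1 : Matrix X X ℝ) z w| * Real.exp (δ * (ρ z w / 1)) ≤ 1 := by
        intro z w
        by_cases h : z = w
        · subst h; simp [hρ0]
        · simp [h]
      have hBu : ∀ y, ∑ w, |(G 0 * D₂) w y| * Real.exp (δ * (ρ w y / 1)) ≤ CB := fun y => by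
        simpa using hB 0 y
      have h := sandwich_pointwise D₁ 1 (G 0 * D₂) ρ one_pos hδ htri hDu hone hBu x y
      have hE : 0 ≤ Real.exp (-(δ * (ρ x y / L ^ 0))) / (L ^ 0) ^ d := by positivity
      calc |sliceKernel₂ G K D₁ D₂ 0 x y| = |(D₁ * (1 : Matrix X X ℝ) * (G 0 * D₂)) x y| := by
            simp [sliceKernel₂, Matrix.mul_assoc]
        _ ≤ CD * CB * 1 * Real.exp (-(δ * (ρ x y / 1))) := h
        _ = CD * CB * (Real.exp (-(δ * (ρ x y / L ^ 0))) / (L ^ 0) ^ d) := by simp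
        _ ≤ (CD * CB + CA' * CB * CP) * (Real.exp (-(δ * (ρ x y / L ^ 0))) / (L ^ 0) ^ d) :=
            mul_le_mul_of_nonneg_right h1 hE
  | succ j =>
      have hs : 0 < L ^ j := pow_pos hL0 _
      have hss : L ^ j ≤ L ^ (j + 1) := by
        rw [pow_succ]
        exact le_mul_of_one_le_right hs.le hL
      have hA'' : ∀ x, ∑ z, |(D₁ * G j) x z| * Real.exp (δ * (ρ x z / L ^ (j + 1))) ≤ CA' * L ^ (j + 1) := by
        intro x
        calc ∑ z, |(D₁ * G j) x z| * Real.exp (δ * (ρ x z / L ^ (j + 1)))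
            ≤ ∑ z, |(D₁ * G j) x z| * Real.exp (δ * (ρ x z / L ^ j)) :=
              weightedSum_mono_scale (fun z => |(D₁ * G j) x z|) (fun z => ρ x z) hδ (fun z => abs_nonneg _)
                (fun z => hρ x z) hs hss
          _ ≤ CA' * L ^ j := hA' j x
          _ ≤ CA' * L ^ (j + 1) := mul_le_mul_of_nonneg_left hss hCA'
      have h := slice_bound_of_operatorData₂ (D₁ * G j) (K j - K (j + 1)) (G (j + 1) * D₂) ρ j hL0 hδ hCA' hCB
        htri hA'' (hP j) (hB (j + 1)) le_rfl le_rfl le_rfl x y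
      have hE : 0 ≤ Real.exp (-(δ * (ρ x y / L ^ (j + 1)))) / (L ^ (j + 1)) ^ d := by positivity
      calc |sliceKernel₂ G K D₁ D₂ (j + 1) x y|
          = |(D₁ * G j * (K j - K (j + 1)) * (G (j + 1) * D₂)) x y| := by simp [sliceKernel₂]
        _ ≤ CA' * CB * CP * (Real.exp (-(δ * (ρ x y / L ^ (j + 1)))) / (L ^ (j + 1)) ^ d) := h
        _ ≤ (CD * CB + CA' * CB * CP) * (Real.exp (-(δ * (ρ x y / L ^ (j + 1)))) / (L ^ (j + 1)) ^ d) :=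
            mul_le_mul_of_nonneg_right h2 hE

end Assembly

/-! ## §5  Printed TYPE by name: the tree's B9 predicates bridged to the cube-localised hypotheses -/
section PrintedType

variable {g : B9.Geometry} {Bg : B9.Backgrounds}

/-- Entry `0` of the (3.42) prefactor vector `[t², t, t, 1]` (definitional unfolding of `B9.pref4`). [folklore] -/
@[simp] theorem pref4_zero (t : ℝ) : B9.pref4 t 0 = t ^ 2 := rfl
/-- Entry `1` of the (3.42) prefactor vector `[t², t, t, 1]` (definitional unfolding of `B9.pref4`). [folklore] -/
@[simp] theorem pref4_one (t : ℝ) : B9.pref4 t 1 = t := rfl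

/-- The (3.42) prefactors `[t², t, t, 1]` are monotone in the scale length `t ≥ 0`. [folklore] -/
theorem pref4_mono {t s : ℝ} (ht : 0 ≤ t) (hts : t ≤ s) : ∀ m : Fin 4, B9.pref4 t m ≤ B9.pref4 s m := by
  intro m
  fin_cases m
  · show t ^ 2 ≤ s ^ 2; exact pow_le_pow_left₀ ht hts 2
  · show t ≤ s; exact hts
  · show t ≤ s; exact hts
  · show (1 : ℝ) ≤ 1; exact le_rfl

/-- ROW-OBSERVATION DICTIONARY (hypothesis shape, not printed; the matrix relative of `B9Ineq349.ObservedBy`): the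
fine kernel `A` (rows indexed by fine points `x`, each lying in the cube `cube x`) has its row mass on every cube `y₁`
OBSERVED BY entry `m` of (3.42) — there is a test function `λ` with `supp λ ⊂ Δ(y₁)`, `|λ| ≤ 1` (the transported sign
pattern of the row on the cube: a `Q*`-type piecewise extension with unitary transporters) such that
`Σ_{z ∈ y₁}|A x z| ≤ (Gp.e m U λ)(cube x)`.  The unprinted "kernel form" of Theorem 3.1 (cell GAPS G-pv16-1, located);
a predicate — never used as a fact. [model] [folklore] -/
def RowObservedBy {X : Type*} [Fintype X] [DecidableEq g.Site] (Gp : B9.KernelFamily g Bg) (U : Bg.Cfg) (m : Fin 4)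
    (A : Matrix X X ℝ) (cube : X → g.Site) : Prop :=
  ∀ (x : X) (y₁ : g.Site), ∃ lam : g.Loc, g.suppIn lam y₁ ∧ g.supNorm lam ≤ 1 ∧
    ∑ z ∈ Finset.univ.filter (fun z => cube z = y₁), |A x z| ≤ Gp.e m U lam (cube x)

/-- **Cube-localised row bound from (3.42) BY NAME.**  The tree's typed statement `B9.Ineq342_346_347 Gp B₀ δ₀ U`
(B9 Thm 3.1, (3.42)/(3.46)/(3.47) at one configuration — a HYPOTHESIS here) and the row-observation dictionary give
`Σ_{z∈y₁}|A x z| ≤ B₀·pref4(len(cube x))_m·e^{−δ₀d(cube x, y₁)}`.  (The proof is `B9Ineq349.kernel_of_342`'s, for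
row masses; (3.42) enters ONLY as the hypothesis `h342`.) [folklore] -/
theorem rowLocalised_of_342 {X : Type*} [Fintype X] [DecidableEq g.Site] (Gp : B9.KernelFamily g Bg) (U : Bg.Cfg) {B₀ δ₀ : ℝ}
    (hB₀ : 0 ≤ B₀) (hlen : ∀ y : g.Site, 0 ≤ g.len y) (h342 : B9.Ineq342_346_347 Gp B₀ δ₀ U) (m : Fin 4)
    (A : Matrix X X ℝ) (cube : X → g.Site) (hobs : RowObservedBy Gp U m A cube) (x : X) (y₁ : g.Site) :
    ∑ z ∈ Finset.univ.filter (fun z => cube z = y₁), |A x z|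
      ≤ B₀ * B9.pref4 (g.len (cube x)) m * Real.exp (-(δ₀ * g.dist (cube x) y₁)) := by
  obtain ⟨lam, hsupp, hnorm, hle⟩ := hobs x y₁
  have h := h342.1 m lam (cube x) y₁ hsupp
  have hnn : 0 ≤ B₀ * B9.pref4 (g.len (cube x)) m * Real.exp (-(δ₀ * g.dist (cube x) y₁)) :=
    mul_nonneg (mul_nonneg hB₀ (B9FromB6.pref4_nonneg (hlen _) m)) (Real.exp_nonneg _)
  calc _ ≤ Gp.e m U lam (cube x) := hle
    _ ≤ B₀ * B9.pref4 (g.len (cube x)) m * Real.exp (-(δ₀ * g.dist (cube x) y₁)) * g.supNorm lam := h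
    _ ≤ B₀ * B9.pref4 (g.len (cube x)) m * Real.exp (-(δ₀ * g.dist (cube x) y₁)) * 1 :=
        mul_le_mul_of_nonneg_left hnorm hnn
    _ = _ := mul_one _

/-- **The `hloc` input of `weightedRow_of_cubeData` from (3.42) BY NAME, at one scale**: all cubes of the level
have length `≤ s` (lattice units, single-scale family) and the integer block distance `nbd` is dominated by B9's scaled
distance `d(·,·)` [reading (I′)/(I″), geometry]: `Σ_{z∈y₁}|A x z| ≤ B₀·pref4(s)_m·e^{−δ₀·nbd(cube x, y₁)}`.
Items `m = 0` (`pref4 s 0 = s²`: the rows of `G⁽ʲ⁾`, input (A)) and `m = 1` (`pref4 s 1 = s`: the rows of `∇_UG⁽ʲ⁾`,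
input (A′); for `(G⁽ʲ⁾∇*)ᵀ = ∇_UG⁽ʲ⁾` — `G` Hermitian [model] — input (B) via `colLocalised_of_transpose`);
(3.42) enters ONLY as the hypothesis `h342`. [folklore] -/
theorem cubeData_of_342 {X : Type*} [Fintype X] [DecidableEq g.Site] (Gp : B9.KernelFamily g Bg) (U : Bg.Cfg) {B₀ δ₀ s : ℝ}
    (hB₀ : 0 ≤ B₀) (hδ₀ : 0 ≤ δ₀) (hlen : ∀ y : g.Site, 0 ≤ g.len y) (hlens : ∀ y : g.Site, g.len y ≤ s)
    (h342 : B9.Ineq342_346_347 Gp B₀ δ₀ U) (m : Fin 4) (A : Matrix X X ℝ) (cube : X → g.Site)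
    (hobs : RowObservedBy Gp U m A cube) (nbd : g.Site → g.Site → ℕ)
    (hbd : ∀ y y₁, (nbd y y₁ : ℝ) ≤ g.dist y y₁) (x : X) (y₁ : g.Site) :
    ∑ z ∈ Finset.univ.filter (fun z => cube z = y₁), |A x z|
      ≤ B₀ * B9.pref4 s m * Real.exp (-(δ₀ * nbd (cube x) y₁)) := by
  have h := rowLocalised_of_342 Gp U hB₀ hlen h342 m A cube hobs x y₁
  have h1 : B9.pref4 (g.len (cube x)) m ≤ B9.pref4 s m := pref4_mono (hlen _) (hlens _) m
  have h2 : Real.exp (-(δ₀ * g.dist (cube x) y₁)) ≤ Real.exp (-(δ₀ * nbd (cube x) y₁)) :=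
    Real.exp_le_exp.2 (by nlinarith [hbd (cube x) y₁])
  have hp : 0 ≤ B9.pref4 s m := B9FromB6.pref4_nonneg (le_trans (hlen (cube x)) (hlens _)) m
  calc _ ≤ B₀ * B9.pref4 (g.len (cube x)) m * Real.exp (-(δ₀ * g.dist (cube x) y₁)) := h
    _ ≤ B₀ * B9.pref4 s m * Real.exp (-(δ₀ * nbd (cube x) y₁)) :=
        mul_le_mul (mul_le_mul_of_nonneg_left h1 hB₀) h2 (Real.exp_nonneg _) (mul_nonneg hB₀ hp)

/-- Column masses on cubes are row masses of the transpose (the (B) side of the dictionary: for the real objects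
`(G⁽ʲ⁾∇*)ᵀ = ∇_UG⁽ʲ⁾` by Hermiticity, observed by item 1 of (3.42)). [folklore] -/
theorem colLocalised_of_transpose {X B : Type*} [Fintype X] (M : Matrix X X ℝ) (cube : X → B)
    (f : X → B → ℝ) [DecidableEq B]
    (h : ∀ y b, ∑ w ∈ Finset.univ.filter (fun w => cube w = b), |M.transpose y w| ≤ f y b) :
    ∀ y b, ∑ w ∈ Finset.univ.filter (fun w => cube w = b), |M w y| ≤ f y b := by
  intro y b
  simpa [Matrix.transpose_apply] using h y b

/-- ENTRY-DOMINATION DICTIONARY for (3.49) (hypothesis shape): the entries of the fine kernel `Pm` are dominated by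
the (3.49)-quantity `P.ker n U (cube z) (cube w)` — for the real objects `P.ker` IS the sup over the two cubes, so the
domination is an instance of `le_sup`; a predicate — never used as a fact. [model] [folklore] -/
def EntryDominated {X : Type*} (P : B9.FineKernel g Bg) (U : Bg.Cfg) (n : Fin 4) (Pm : Matrix X X ℝ)
    (cube : X → g.Site) : Prop :=
  ∀ z w, |Pm z w| ≤ P.ker n U (cube z) (cube w)

/-- **Pointwise bound of a gauge-fixing kernel from (3.49) BY NAME**, item `3` (`DPD*`: prefactor
`(L^jη)^{−2}(L^{j′}η)^{−d}`), at one scale in lattice units (`len ≡ s`):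
`|Pm z w| ≤ (C/s^{d+2})·e^{−(δ₀/2)d(cube z, cube w)}` — the gauge-fixing input of (P_j) (reading (I″)); (3.49) enters
ONLY as the hypothesis `h349 : B9.Ineq349 d P C δ₀ U`. [folklore] -/
theorem pointwise_item3_of_349 {X : Type*} (P : B9.FineKernel g Bg) (U : Bg.Cfg) {C δ₀ s : ℝ} {d : ℕ}
    (hs : 0 < s) (hlen : ∀ y, g.len y = s) (h349 : B9.Ineq349 d P C δ₀ U) (Pm : Matrix X X ℝ)
    (cube : X → g.Site) (hdom : EntryDominated P U 3 Pm cube) (z w : X) :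
    |Pm z w| ≤ C / s ^ (d + 2) * Real.exp (-(δ₀ / 2 * g.dist (cube z) (cube w))) := by
  have h := h349 3 (cube z) (cube w)
  simp only [hlen] at h
  have hpref : B9.pref4inv s 3 = s⁻¹ ^ 2 := rfl
  have hrpow : s ^ (-(d : ℝ)) = (s ^ d)⁻¹ := by rw [Real.rpow_neg hs.le, Real.rpow_natCast]
  rw [hpref, hrpow] at h
  have hs0 : s ≠ 0 := hs.ne'
  have key : C * s⁻¹ ^ 2 * (s ^ d)⁻¹ = C / s ^ (d + 2) := by
    rw [eq_div_iff (pow_ne_zero _ hs0)]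
    calc C * s⁻¹ ^ 2 * (s ^ d)⁻¹ * s ^ (d + 2)
        = C * ((s⁻¹ * s) ^ 2 * ((s ^ d)⁻¹ * s ^ d)) := by ring
      _ = C := by rw [inv_mul_cancel₀ hs0, inv_mul_cancel₀ (pow_ne_zero _ hs0)]; ring
  calc |Pm z w| ≤ P.ker 3 U (cube z) (cube w) := hdom z w
    _ ≤ C * s⁻¹ ^ 2 * (s ^ d)⁻¹ * Real.exp (-(δ₀ / 2 * g.dist (cube z) (cube w))) := h
    _ = C / s ^ (d + 2) * Real.exp (-(δ₀ / 2 * g.dist (cube z) (cube w))) := by rw [key]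

end PrintedType

/-! ## §5b  The per-level operator data ASSEMBLED from (3.42)/(3.49) by name: (A_j), (B_j), and the gauge part of (P_j)
with level-free constants — what a successor instantiates is exactly `h342`/`h349`, the two dictionaries, and geometry -/
section Assembled

variable {g : B9.Geometry} {Bg : B9.Backgrounds}

/-- **Weighted row bound from (3.42) BY NAME, assembled** (§3 + §5): at one level with cubes of length `≤ s`
(`0 < s`), integer block distance `nbd ≤ d(·,·)`, fine distance `ρ x z ≤ s·nbd(cube x, cube z) + c·s`, shell counts
`#{b : nbd b₀ b = r} ≤ A′(r+1)^p` around every cube `b₀`, and `0 ≤ δ < δ₀`: the hypothesis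
`B9.Ineq342_346_347 Gp B₀ δ₀ U` and the row-observation dictionary for item `m` give
`Σ_z |A x z|·e^{δρ(x,z)/s} ≤ B₀·pref4(s)_m·e^{δc}·A′·countConst(δ₀ − δ) p` for every row `x`.
(3.42) enters ONLY as the hypothesis `h342`. [folklore] -/
theorem weightedRow_of_342 {X : Type*} [Fintype X] [Fintype g.Site] [DecidableEq g.Site]
    (Gp : B9.KernelFamily g Bg) (U : Bg.Cfg) {B₀ δ₀ δ s c A' : ℝ} {p : ℕ} (hB₀ : 0 ≤ B₀) (hδ : 0 ≤ δ)
    (hδ₀ : δ < δ₀) (hs : 0 < s) (hA' : 0 ≤ A') (hlen : ∀ y : g.Site, 0 ≤ g.len y)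
    (hlens : ∀ y : g.Site, g.len y ≤ s) (h342 : B9.Ineq342_346_347 Gp B₀ δ₀ U) (m : Fin 4) (A : Matrix X X ℝ)
    (cube : X → g.Site) (hobs : RowObservedBy Gp U m A cube) (nbd : g.Site → g.Site → ℕ)
    (hbd : ∀ y y₁, (nbd y y₁ : ℝ) ≤ g.dist y y₁) (ρ : X → X → ℝ)
    (hρ : ∀ x z, ρ x z ≤ s * nbd (cube x) (cube z) + c * s)
    (hcount : ∀ (b₀ : g.Site) (r : ℕ),
      ((Finset.univ.filter fun b => nbd b₀ b = r).card : ℝ) ≤ A' * ((r : ℝ) + 1) ^ p) :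
    ∀ x, ∑ z, |A x z| * Real.exp (δ * (ρ x z / s))
      ≤ B₀ * B9.pref4 s m * Real.exp (δ * c) * (A' * countConst (δ₀ - δ) p) := by
  intro x
  have hδ₀' : 0 ≤ δ₀ := le_trans hδ hδ₀.le
  exact weightedRow_of_cubeData cube (fun z => |A x z|) (fun z => ρ x z) (nbd (cube x)) hs hδ hδ₀
    (fun z => abs_nonneg _) (mul_nonneg hB₀ (B9FromB6.pref4_nonneg ((hlen (cube x)).trans (hlens _)) m)) hA'
    (fun b => cubeData_of_342 Gp U hB₀ hδ₀' hlen hlens h342 m A cube hobs nbd hbd x b)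
    (fun z => hρ x z) (hcount (cube x))

/-- **Weighted column bound from (3.42) BY NAME, assembled**: the same for the COLUMNS of `M`, observed through the
rows of `Mᵀ` ([model]: `(G⁽ʲ⁾∇*)ᵀ = ∇_UG⁽ʲ⁾` for Hermitian `G`, item `m = 1`). [folklore] -/
theorem weightedCol_of_342 {X : Type*} [Fintype X] [Fintype g.Site] [DecidableEq g.Site]
    (Gp : B9.KernelFamily g Bg) (U : Bg.Cfg) {B₀ δ₀ δ s c A' : ℝ} {p : ℕ} (hB₀ : 0 ≤ B₀) (hδ : 0 ≤ δ)
    (hδ₀ : δ < δ₀) (hs : 0 < s) (hA' : 0 ≤ A') (hlen : ∀ y : g.Site, 0 ≤ g.len y)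
    (hlens : ∀ y : g.Site, g.len y ≤ s) (h342 : B9.Ineq342_346_347 Gp B₀ δ₀ U) (m : Fin 4) (M : Matrix X X ℝ)
    (cube : X → g.Site) (hobs : RowObservedBy Gp U m M.transpose cube) (nbd : g.Site → g.Site → ℕ)
    (hbd : ∀ y y₁, (nbd y y₁ : ℝ) ≤ g.dist y y₁) (ρ : X → X → ℝ)
    (hρ : ∀ w y, ρ w y ≤ s * nbd (cube y) (cube w) + c * s)
    (hcount : ∀ (b₀ : g.Site) (r : ℕ),
      ((Finset.univ.filter fun b => nbd b₀ b = r).card : ℝ) ≤ A' * ((r : ℝ) + 1) ^ p) :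
    ∀ y, ∑ w, |M w y| * Real.exp (δ * (ρ w y / s))
      ≤ B₀ * B9.pref4 s m * Real.exp (δ * c) * (A' * countConst (δ₀ - δ) p) := by
  intro y
  have h := weightedRow_of_342 Gp U hB₀ hδ hδ₀ hs hA' hlen hlens h342 m M.transpose cube hobs nbd hbd
    (fun y w => ρ w y) (fun y w => hρ w y) hcount y
  simpa [Matrix.transpose_apply] using h

/-- **(A_j) literally** (the binder `hArow`/`hA` of the junctions at one level `j`): item `0` of (3.42) at `s = L^j`
gives `Σ_z |G x z|·e^{δρ(x,z)/L^j} ≤ C_A·(L^j)²` with the LEVEL-FREE `C_A = B₀e^{δc}A′·countConst(δ₀ − δ) p`. [folklore] -/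
theorem opDataA_of_342 {X : Type*} [Fintype X] [Fintype g.Site] [DecidableEq g.Site]
    (Gp : B9.KernelFamily g Bg) (U : Bg.Cfg) {B₀ δ₀ δ L c A' : ℝ} {p : ℕ} (j : ℕ) (hB₀ : 0 ≤ B₀) (hδ : 0 ≤ δ)
    (hδ₀ : δ < δ₀) (hL : 1 ≤ L) (hA' : 0 ≤ A') (hlen : ∀ y : g.Site, 0 ≤ g.len y)
    (hlens : ∀ y : g.Site, g.len y ≤ L ^ j) (h342 : B9.Ineq342_346_347 Gp B₀ δ₀ U) (G : Matrix X X ℝ)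
    (cube : X → g.Site) (hobs : RowObservedBy Gp U 0 G cube) (nbd : g.Site → g.Site → ℕ)
    (hbd : ∀ y y₁, (nbd y y₁ : ℝ) ≤ g.dist y y₁) (ρ : X → X → ℝ)
    (hρ : ∀ x z, ρ x z ≤ L ^ j * nbd (cube x) (cube z) + c * L ^ j)
    (hcount : ∀ (b₀ : g.Site) (r : ℕ),
      ((Finset.univ.filter fun b => nbd b₀ b = r).card : ℝ) ≤ A' * ((r : ℝ) + 1) ^ p) :
    ∀ x, ∑ z, |G x z| * Real.exp (δ * (ρ x z / L ^ j))
      ≤ B₀ * Real.exp (δ * c) * (A' * countConst (δ₀ - δ) p) * (L ^ j) ^ 2 := by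
  intro x
  have hLj : 0 < L ^ j := pow_pos (by linarith) j
  have h := weightedRow_of_342 Gp U hB₀ hδ hδ₀ hLj hA' hlen hlens h342 0 G cube hobs nbd hbd ρ hρ hcount x
  rw [pref4_zero] at h
  exact h.trans (le_of_eq (by ring))

/-- **(B_j) literally** (the binder `hBcol`/`hB` of the junctions at one level `j`): item `1` of (3.42) for the
transpose of `M = G⁽ʲ⁾·D` at `s = L^j` gives `Σ_w |M w y|·e^{δρ(w,y)/L^j} ≤ C_B·L^j`, `C_B = B₀e^{δc}A′·countConst(δ₀ − δ) p`
LEVEL-FREE. [folklore] -/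
theorem opDataB_of_342 {X : Type*} [Fintype X] [Fintype g.Site] [DecidableEq g.Site]
    (Gp : B9.KernelFamily g Bg) (U : Bg.Cfg) {B₀ δ₀ δ L c A' : ℝ} {p : ℕ} (j : ℕ) (hB₀ : 0 ≤ B₀) (hδ : 0 ≤ δ)
    (hδ₀ : δ < δ₀) (hL : 1 ≤ L) (hA' : 0 ≤ A') (hlen : ∀ y : g.Site, 0 ≤ g.len y)
    (hlens : ∀ y : g.Site, g.len y ≤ L ^ j) (h342 : B9.Ineq342_346_347 Gp B₀ δ₀ U) (M : Matrix X X ℝ)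
    (cube : X → g.Site) (hobs : RowObservedBy Gp U 1 M.transpose cube) (nbd : g.Site → g.Site → ℕ)
    (hbd : ∀ y y₁, (nbd y y₁ : ℝ) ≤ g.dist y y₁) (ρ : X → X → ℝ)
    (hρ : ∀ w y, ρ w y ≤ L ^ j * nbd (cube y) (cube w) + c * L ^ j)
    (hcount : ∀ (b₀ : g.Site) (r : ℕ),
      ((Finset.univ.filter fun b => nbd b₀ b = r).card : ℝ) ≤ A' * ((r : ℝ) + 1) ^ p) :
    ∀ y, ∑ w, |M w y| * Real.exp (δ * (ρ w y / L ^ j))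
      ≤ B₀ * Real.exp (δ * c) * (A' * countConst (δ₀ - δ) p) * L ^ j := by
  intro y
  have hLj : 0 < L ^ j := pow_pos (by linarith) j
  have h := weightedCol_of_342 Gp U hB₀ hδ hδ₀ hLj hA' hlen hlens h342 1 M cube hobs nbd hbd ρ hρ hcount y
  rw [pref4_one] at h
  exact h.trans (le_of_eq (by ring))

/-- **Gauge-fixing kernel at level `j`, weighted at the COARSER scale `L^{j+1}`** (the level-`j` half of the gauge
part of (P_j)): from (3.49) item `3` by name (`len ≡ L^j`), the entry-domination dictionary, and the distance dictionary
`ρ z w ≤ L^j·d(cube z, cube w) + c·L^j` [reading (I″)], for `0 ≤ δ ≤ δ₀/2`: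
`|Pm z w|·e^{δρ(z,w)/L^{j+1}} ≤ C·L^{d+2}·e^{(δ₀/2)c}/(L^{j+1})^{d+2}` — the printed prefactor `(L^jη)^{−(d+2)}` rewritten
at the coarser scale with the level-free factor `L^{d+2}`. [folklore] -/
theorem gauge_weighted_coarser {X : Type*} (P : B9.FineKernel g Bg) (U : Bg.Cfg) {C δ₀ δ L c : ℝ} {d : ℕ}
    (j : ℕ) (hL : 1 ≤ L) (hC : 0 ≤ C) (hδ : 0 ≤ δ) (hδδ₀ : δ ≤ δ₀ / 2) (hlen : ∀ y, g.len y = L ^ j)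
    (h349 : B9.Ineq349 d P C δ₀ U) (Pm : Matrix X X ℝ) (cube : X → g.Site) (hdom : EntryDominated P U 3 Pm cube)
    (ρ : X → X → ℝ) (hρ0 : ∀ z w, 0 ≤ ρ z w) (hdist : ∀ z w, ρ z w ≤ L ^ j * g.dist (cube z) (cube w) + c * L ^ j) :
    ∀ z w, |Pm z w| * Real.exp (δ * (ρ z w / L ^ (j + 1)))
      ≤ C * L ^ (d + 2) * Real.exp (δ₀ / 2 * c) / (L ^ (j + 1)) ^ (d + 2) := by
  have hL0 : 0 < L := by linarith
  have hLj : 0 < L ^ j := pow_pos hL0 j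
  have hLj1 : 0 < L ^ (j + 1) := pow_pos hL0 (j + 1)
  have hδ₀2 : 0 ≤ δ₀ / 2 := le_trans hδ hδδ₀
  -- pointwise bound with decay at scale L^j, then weakened to scale L^(j+1)
  have hP : ∀ z w, |Pm z w| ≤ C * Real.exp (δ₀ / 2 * c) / (L ^ j) ^ (d + 2)
      * Real.exp (-(δ₀ / 2 * (ρ z w / L ^ (j + 1)))) := by
    intro z w
    have h1 := pointwise_item3_of_349 P U hLj hlen h349 Pm cube hdom z w
    -- d(cube z, cube w) ≥ ρ z w / L^j - c
    have hd : ρ z w / L ^ j - c ≤ g.dist (cube z) (cube w) := by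
      rw [sub_le_iff_le_add, div_le_iff₀ hLj]
      nlinarith [hdist z w]
    have h2 : Real.exp (-(δ₀ / 2 * g.dist (cube z) (cube w)))
        ≤ Real.exp (δ₀ / 2 * c) * Real.exp (-(δ₀ / 2 * (ρ z w / L ^ (j + 1)))) := by
      rw [← Real.exp_add]
      apply Real.exp_le_exp.2
      have h3 : ρ z w / L ^ (j + 1) ≤ ρ z w / L ^ j :=
        div_le_div_of_nonneg_left (hρ0 z w) hLj (pow_le_pow_right₀ hL (Nat.le_succ j))
      nlinarith [h3, hd]
    have hC' : 0 ≤ C / (L ^ j) ^ (d + 2) := div_nonneg hC (pow_nonneg hLj.le _)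
    calc |Pm z w| ≤ C / (L ^ j) ^ (d + 2) * Real.exp (-(δ₀ / 2 * g.dist (cube z) (cube w))) := h1
      _ ≤ C / (L ^ j) ^ (d + 2) * (Real.exp (δ₀ / 2 * c) * Real.exp (-(δ₀ / 2 * (ρ z w / L ^ (j + 1))))) :=
          mul_le_mul_of_nonneg_left h2 hC'
      _ = _ := by ring
  have hp₀ : 0 ≤ C * Real.exp (δ₀ / 2 * c) / (L ^ j) ^ (d + 2) :=
    div_nonneg (mul_nonneg hC (Real.exp_nonneg _)) (pow_nonneg hLj.le _)
  have hw := pointwise_weighted_of_expLocal Pm ρ hδδ₀ hρ0 hLj1 hp₀ hP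
  intro z w
  have hscale : C * Real.exp (δ₀ / 2 * c) / (L ^ j) ^ (d + 2)
      = C * L ^ (d + 2) * Real.exp (δ₀ / 2 * c) / (L ^ (j + 1)) ^ (d + 2) := by
    rw [div_eq_div_iff (pow_ne_zero _ hLj.ne') (pow_ne_zero _ hLj1.ne')]
    ring
  rw [← hscale]
  exact hw z w

/-- **Gauge-fixing kernel at its own level, weighted at its own scale**: (3.49) item `3` by name (`len ≡ s`), the
entry-domination and distance dictionaries (`ρ z w ≤ s·d(cube z, cube w) + c·s`), `0 ≤ δ ≤ δ₀/2`:
`|Pm z w|·e^{δρ(z,w)/s} ≤ C·e^{(δ₀/2)c}/s^{d+2}`. [folklore] -/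
theorem gauge_weighted_own {X : Type*} (P : B9.FineKernel g Bg) (U : Bg.Cfg) {C δ₀ δ s c : ℝ} {d : ℕ}
    (hs : 0 < s) (hC : 0 ≤ C) (hδ : 0 ≤ δ) (hδδ₀ : δ ≤ δ₀ / 2) (hlen : ∀ y, g.len y = s)
    (h349 : B9.Ineq349 d P C δ₀ U) (Pm : Matrix X X ℝ) (cube : X → g.Site) (hdom : EntryDominated P U 3 Pm cube)
    (ρ : X → X → ℝ) (hρ0 : ∀ z w, 0 ≤ ρ z w) (hdist : ∀ z w, ρ z w ≤ s * g.dist (cube z) (cube w) + c * s) :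
    ∀ z w, |Pm z w| * Real.exp (δ * (ρ z w / s)) ≤ C * Real.exp (δ₀ / 2 * c) / s ^ (d + 2) := by
  have hP : ∀ z w, |Pm z w| ≤ C * Real.exp (δ₀ / 2 * c) / s ^ (d + 2)
      * Real.exp (-(δ₀ / 2 * (ρ z w / s))) := by
    intro z w
    have h1 := pointwise_item3_of_349 P U hs hlen h349 Pm cube hdom z w
    have hd : ρ z w / s - c ≤ g.dist (cube z) (cube w) := by
      rw [sub_le_iff_le_add, div_le_iff₀ hs]
      nlinarith [hdist z w]
    have h2 : Real.exp (-(δ₀ / 2 * g.dist (cube z) (cube w)))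
        ≤ Real.exp (δ₀ / 2 * c) * Real.exp (-(δ₀ / 2 * (ρ z w / s))) := by
      rw [← Real.exp_add]
      apply Real.exp_le_exp.2
      have hδ₀2 : 0 ≤ δ₀ / 2 := le_trans hδ hδδ₀
      nlinarith [hd]
    have hC' : 0 ≤ C / s ^ (d + 2) := div_nonneg hC (pow_nonneg hs.le _)
    calc |Pm z w| ≤ C / s ^ (d + 2) * Real.exp (-(δ₀ / 2 * g.dist (cube z) (cube w))) := h1
      _ ≤ C / s ^ (d + 2) * (Real.exp (δ₀ / 2 * c) * Real.exp (-(δ₀ / 2 * (ρ z w / s)))) :=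
          mul_le_mul_of_nonneg_left h2 hC'
      _ = _ := by ring
  have hp₀ : 0 ≤ C * Real.exp (δ₀ / 2 * c) / s ^ (d + 2) :=
    div_nonneg (mul_nonneg hC (Real.exp_nonneg _)) (pow_nonneg hs.le _)
  exact pointwise_weighted_of_expLocal Pm ρ hδδ₀ hρ0 hs hp₀ hP

/-- **The gauge part of (P_j) across two levels** (levels `j` and `j+1` live on two geometries `g`, `g'` with cube
lengths `L^j`, `L^{j+1}`; (3.49) by name at each level with LEVEL-FREE `C, δ₀`; NO cancellation between the levels):
`|(N_j − N_{j+1}) z w|·e^{δρ(z,w)/L^{j+1}} ≤ C(L^{d+2} + 1)e^{(δ₀/2)c}/(L^{j+1})^{d+2}` — the same shape as the mass part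
`massDiff_weighted_scaled`. [folklore] -/
theorem gaugeDiff_weighted_scaled {X : Type*} {g' : B9.Geometry} {Bg' : B9.Backgrounds}
    (P : B9.FineKernel g Bg) (U : Bg.Cfg) (P' : B9.FineKernel g' Bg') (U' : Bg'.Cfg) {C δ₀ δ L c : ℝ} {d : ℕ}
    (j : ℕ) (hL : 1 ≤ L) (hC : 0 ≤ C) (hδ : 0 ≤ δ) (hδδ₀ : δ ≤ δ₀ / 2)
    (hlen : ∀ y, g.len y = L ^ j) (hlen' : ∀ y, g'.len y = L ^ (j + 1))
    (h349 : B9.Ineq349 d P C δ₀ U) (h349' : B9.Ineq349 d P' C δ₀ U')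
    (N N' : Matrix X X ℝ) (cube : X → g.Site) (cube' : X → g'.Site)
    (hdom : EntryDominated P U 3 N cube) (hdom' : EntryDominated P' U' 3 N' cube')
    (ρ : X → X → ℝ) (hρ0 : ∀ z w, 0 ≤ ρ z w) (hdist : ∀ z w, ρ z w ≤ L ^ j * g.dist (cube z) (cube w) + c * L ^ j)
    (hdist' : ∀ z w, ρ z w ≤ L ^ (j + 1) * g'.dist (cube' z) (cube' w) + c * L ^ (j + 1)) :
    ∀ z w, |(N - N') z w| * Real.exp (δ * (ρ z w / L ^ (j + 1)))
      ≤ C * (L ^ (d + 2) + 1) * Real.exp (δ₀ / 2 * c) / (L ^ (j + 1)) ^ (d + 2) := by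
  have hLj1 : 0 < L ^ (j + 1) := pow_pos (by linarith) (j + 1)
  have h1 := gauge_weighted_coarser P U j hL hC hδ hδδ₀ hlen h349 N cube hdom ρ hρ0 hdist
  have h2 := gauge_weighted_own P' U' hLj1 hC hδ hδδ₀ hlen' h349' N' cube' hdom' ρ hρ0 hdist'
  have h := pointwise_weighted_sub N N' (fun z w => Real.exp (δ * (ρ z w / L ^ (j + 1))))
    (fun z w => Real.exp_nonneg _) h1 h2
  intro z w
  refine (h z w).trans (le_of_eq ?_)
  ring

/-- **(P_j) literally, mass + gauge** (the binder `hPpt`/`hP` of the junctions at one level `j`): with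
`K j = M_j + N_j` (mass kernel + gauge-fixing kernel [model: B7 (14)/(124) + B9 (3.20)–(3.25)]), the two parts'
weighted two-level differences add: `|((M + N) − (M′ + N′)) z w|·E z w ≤ π_M + π_N`. [folklore] -/
theorem opDataP_of_parts {X : Type*} (M M' N N' : Matrix X X ℝ) (E : X → X → ℝ) {πM πN : ℝ}
    (hE : ∀ z w, 0 ≤ E z w) (hM : ∀ z w, |(M - M') z w| * E z w ≤ πM)
    (hN : ∀ z w, |(N - N') z w| * E z w ≤ πN) :
    ∀ z w, |((M + N) - (M' + N')) z w| * E z w ≤ πM + πN := by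
  have h := pointwise_weighted_add (M - M') (N - N') E hE hM hN
  intro z w
  have heq : (M + N) - (M' + N') = (M - M') + (N - N') := by abel
  rw [heq]
  exact h z w

end Assembled

/-! ## §6  Junctions BY NAME: clause (T2), the face kernel, and `NE3Shape` from operator data -/
section Junctions

/-- **Clause (T2) from per-level OPERATOR data** (`consistencyT2_of_slices` with its `hg` DISCHARGED by
`sliceKernel_bound_of_opData`): the double-layer constant obeys `dl k V ≤ C_DL(1 + k log L)`,
`C_DL = 2C + A·C·K_δ(1 + log ℓ)`, `C = C_B(1 + C_A·C_P)`. [folklore] -/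
theorem consistencyT2_of_opData {ι : Type*} {dom : Set ι} {X : ℕ → Type*} [∀ k, Fintype (X k)]
    (F : ∀ k, Finset (X k)) (nρ : ∀ k, X k → X k → ℕ)
    (G K : ∀ k, ι → ℕ → Matrix (X k) (X k) ℝ) (D : ∀ k, ι → Matrix (X k) (X k) ℝ)
    (N : ℕ → ℕ) (dl : ℕ → ι → ℝ) {L δ CA CB CP A ℓ : ℝ} {d : ℕ}
    (hL : 2 ≤ L) (hδ : 0 < δ) (hCA : 0 ≤ CA) (hCB : 0 ≤ CB) (hCP : 0 ≤ CP) (hA : 0 ≤ A) (hℓ : 1 ≤ ℓ)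
    (hd : 2 ≤ d) (hzero : ∀ k, ∀ x y : X k, nρ k x y = 0 → y = x)
    (htri : ∀ k, ∀ x z w y : X k, nρ k x y ≤ nρ k x z + nρ k z w + nρ k w y)
    (hFN : ∀ k, ∀ x : X k, ∀ y ∈ F k, nρ k x y ≤ N k) (hN : ∀ k, (N k : ℝ) ≤ ℓ * L ^ k)
    (hcard : ∀ k, ∀ x : X k, ∀ r : ℕ, 1 ≤ r →
      (((F k).filter fun y => nρ k x y = r).card : ℝ) ≤ A * (r : ℝ) ^ (d - 2))
    (hArow : ∀ k, ∀ V ∈ dom, ∀ j, ∀ x : X k,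
      ∑ z, |G k V j x z| * Real.exp (δ * ((nρ k x z : ℝ) / L ^ j)) ≤ CA * (L ^ j) ^ 2)
    (hPpt : ∀ k, ∀ V ∈ dom, ∀ j, ∀ z w : X k,
      |(K k V j - K k V (j + 1)) z w| * Real.exp (δ * ((nρ k z w : ℝ) / L ^ (j + 1)))
        ≤ CP / (L ^ (j + 1)) ^ (d + 2))
    (hBcol : ∀ k, ∀ V ∈ dom, ∀ j, ∀ y : X k,
      ∑ w, |(G k V j * D k V) w y| * Real.exp (δ * ((nρ k w y : ℝ) / L ^ j)) ≤ CB * L ^ j)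
    (hdl : ∀ k, ∀ V ∈ dom, ∃ x : X k,
      dl k V ≤ ∑ y ∈ F k, |∑ i ∈ Finset.range (k + 1), sliceKernel (G k V) (K k V) (D k V) i x y|) :
    ∀ k : ℕ, ∀ V ∈ dom,
      dl k V ≤ (2 * (CB * (1 + CA * CP)) + A * ((CB * (1 + CA * CP)) * sliceConst δ (d - 1)) * (1 + Real.log ℓ))
        * (1 + k * Real.log L) :=
  consistencyT2_of_slices F nρ (fun k V i => sliceKernel (G k V) (K k V) (D k V) i) N dl hL hδ
    (mul_nonneg hCB (by nlinarith [mul_nonneg hCA hCP])) hA hℓ hd hzero hFN hN hcard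
    (fun k V hV i _ x y => sliceKernel_bound_of_opData (G k V) (K k V) (D k V) (fun x y => (nρ k x y : ℝ))
      (by omega) (by linarith) hδ.le hCA hCB hCP (fun x y => Nat.cast_nonneg _)
      (fun x z w y => by exact_mod_cast htri k x z w y) (hArow k V hV) (hPpt k V hV) (hBcol k V hV) i x y)
    hdl

/-- **The two kernel hypotheses of `T4DefectFluxForm.faceColumn_sum_le` from per-level OPERATOR data**
(`faceKernel_of_slices` with its `hg` DISCHARGED by `sliceKernel₂_bound_of_opData`): off the diagonal
`|Σ_{i<n} slices| ≤ C·K_{δ,d}/ρ^d`, and `≤ 2C` everywhere, `C = C_D C_B + C_A′ C_B C_P`. [folklore] -/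
theorem faceKernel_of_opData {X : Type*} [Fintype X] [DecidableEq X] (G K : ℕ → Matrix X X ℝ)
    (D₁ D₂ : Matrix X X ℝ) (ρ : X → X → ℕ) {L δ CA' CB CP CD : ℝ} {d : ℕ} (n : ℕ) (hL : 2 ≤ L)
    (hδ : 0 < δ) (hCA' : 0 ≤ CA') (hCB : 0 ≤ CB) (hCP : 0 ≤ CP) (hCD : 0 ≤ CD) (hd : 1 ≤ d)
    (hρ0 : ∀ z, ρ z z = 0) (htri : ∀ x z w y, ρ x y ≤ ρ x z + ρ z w + ρ w y)
    (hA' : ∀ j x, ∑ z, |(D₁ * G j) x z| * Real.exp (δ * ((ρ x z : ℝ) / L ^ j)) ≤ CA' * L ^ j)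
    (hP : ∀ j z w, |(K j - K (j + 1)) z w| * Real.exp (δ * ((ρ z w : ℝ) / L ^ (j + 1)))
      ≤ CP / (L ^ (j + 1)) ^ (d + 2))
    (hB : ∀ j y, ∑ w, |(G j * D₂) w y| * Real.exp (δ * ((ρ w y : ℝ) / L ^ j)) ≤ CB * L ^ j)
    (hD : ∀ x, ∑ z, |D₁ x z| * Real.exp (δ * (ρ x z : ℝ)) ≤ CD) (z : X) :
    (∀ w, 1 ≤ ρ z w → |∑ i ∈ Finset.range n, sliceKernel₂ G K D₁ D₂ i z w|
        ≤ (CD * CB + CA' * CB * CP) * sliceConst δ d / (ρ z w : ℝ) ^ d) ∧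
    (∀ w, |∑ i ∈ Finset.range n, sliceKernel₂ G K D₁ D₂ i z w| ≤ 2 * (CD * CB + CA' * CB * CP)) :=
  faceKernel_of_slices (sliceKernel₂ G K D₁ D₂) ρ n hL hδ
    (add_nonneg (mul_nonneg hCD hCB) (mul_nonneg (mul_nonneg hCA' hCB) hCP)) hd
    (fun i _ x y => sliceKernel₂_bound_of_opData G K D₁ D₂ (fun x y => (ρ x y : ℝ)) (by linarith) hδ.le hCA' hCB
      hCP hCD (fun x y => Nat.cast_nonneg _) (fun z => by exact_mod_cast hρ0 z)
      (fun x z w y => by exact_mod_cast htri x z w y) hA' hP hB hD i x y) z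

/-- **`NE3Shape` at rate `L^{−a}` from per-level OPERATOR data** (`ne3Shape_of_slices_rpow` with its `hg`
DISCHARGED; every other binder — the geometry, the wall clauses `h1`/`h3`/`h4`/`h5`, the readings, the response and
the correction rate — passed through BY NAME and untouched).  The stability input of the (115)-currency wall is now
(A)/(P)/(B): weighted operator bounds per level at their natural scales, constants level-free. [folklore] -/
theorem ne3Shape_of_opData_rpow {ι Xr : Type*} [Fintype Xr] {R : Readings ι Xr} {X : ℕ → Type*}
    [∀ k, Fintype (X k)] (F : ∀ k, Finset (X k)) (nρ : ∀ k, X k → X k → ℕ)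
    (G K : ∀ k, ι → ℕ → Matrix (X k) (X k) ℝ) (D : ∀ k, ι → Matrix (X k) (X k) ℝ) (N : ℕ → ℕ)
    {z dl sig blk lam t osc nrm pair : ℕ → ι → ℝ}
    {L δ CA CBc CP A ℓ CJ CB B CPo CD B0 CR Γ Λr ρ₂ a : ℝ} {d : ℕ}
    (hL : 2 ≤ L) (ha0 : 0 < a) (ha : a < 1) (hδ : 0 < δ) (hCA : 0 ≤ CA) (hCBc : 0 ≤ CBc) (hCP : 0 ≤ CP)
    (hA : 0 ≤ A) (hℓ : 1 ≤ ℓ) (hd : 2 ≤ d)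
    (hzero : ∀ k, ∀ x y : X k, nρ k x y = 0 → y = x)
    (htri : ∀ k, ∀ x z w y : X k, nρ k x y ≤ nρ k x z + nρ k z w + nρ k w y)
    (hFN : ∀ k, ∀ x : X k, ∀ y ∈ F k, nρ k x y ≤ N k) (hN : ∀ k, (N k : ℝ) ≤ ℓ * L ^ k)
    (hcard : ∀ k, ∀ x : X k, ∀ r : ℕ, 1 ≤ r →
      (((F k).filter fun y => nρ k x y = r).card : ℝ) ≤ A * (r : ℝ) ^ (d - 2))
    (hArow : ∀ k, ∀ V ∈ R.dom, ∀ j, ∀ x : X k,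
      ∑ z, |G k V j x z| * Real.exp (δ * ((nρ k x z : ℝ) / L ^ j)) ≤ CA * (L ^ j) ^ 2)
    (hPpt : ∀ k, ∀ V ∈ R.dom, ∀ j, ∀ z w : X k,
      |(K k V j - K k V (j + 1)) z w| * Real.exp (δ * ((nρ k z w : ℝ) / L ^ (j + 1)))
        ≤ CP / (L ^ (j + 1)) ^ (d + 2))
    (hBcol : ∀ k, ∀ V ∈ R.dom, ∀ j, ∀ y : X k,
      ∑ w, |(G k V j * D k V) w y| * Real.exp (δ * ((nρ k w y : ℝ) / L ^ j)) ≤ CBc * L ^ j)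
    (hdl : ∀ k, ∀ V ∈ R.dom, ∃ x : X k,
      dl k V ≤ ∑ y ∈ F k, |∑ i ∈ Finset.range (k + 1), sliceKernel (G k V) (K k V) (D k V) i x y|)
    (h1 : ∀ k : ℕ, ∀ V ∈ R.dom, z k V ≤ dl k V * sig k V + blk k V)
    (h3 : ∀ k : ℕ, ∀ V ∈ R.dom, 0 ≤ sig k V ∧ sig k V ≤ CJ * lam k V)
    (h4 : ∀ k : ℕ, ∀ V ∈ R.dom, 0 ≤ blk k V ∧ blk k V ≤ CB * (1 + k * Real.log L) * lam k V)
    (h5 : ∀ k : ℕ, ∀ V ∈ R.dom, 0 ≤ lam k V ∧ lam k V ≤ B * (L⁻¹ ^ k) ^ 3)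
    (hCJ : 0 ≤ CJ) (hCB : 0 ≤ CB) (hCPo : 0 ≤ CPo) (hCD : 0 ≤ CD) (hB : 0 ≤ B) (hB0 : 0 ≤ B0) (hCR : 0 ≤ CR)
    (hΓ : 0 ≤ Γ) (hΛr : 0 ≤ Λr) (hρ₂ : 0 ≤ ρ₂)
    (ht : ∀ k : ℕ, ∀ V ∈ R.dom, t k V ≤ B0 * CR * L⁻¹ ^ k)
    (hosc : ∀ k : ℕ, ∀ V ∈ R.dom, osc k V ≤ (1 + CD) * (1 + CPo) * z k V / (L⁻¹ ^ k) ^ 2 + t k V)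
    (hact : ∀ k : ℕ, ∀ V ∈ R.dom, R.act k V = ∑ x, R.loc k V x) (hvol : (Fintype.card Xr : ℝ) ≤ R.vol)
    (hread : ∀ k : ℕ, ∀ V ∈ R.dom, ∀ x : Xr,
      |R.loc (k + 1) V x - R.loc k V x| ≤ Λr * nrm k V + pair k V)
    (hresp : ∀ k : ℕ, ∀ V ∈ R.dom, nrm k V ≤ Γ * osc k V)
    (hpair : OneStepCorrectionRate R.dom pair ρ₂ (L ^ (-a))) :
    NE3Shape R (Λr * Γ * ((1 + CD) * (1 + CPo) *
      ((2 * (CBc * (1 + CA * CP)) + A * ((CBc * (1 + CA * CP)) * sliceConst δ (d - 1)) * (1 + Real.log ℓ)) * CJ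
        + CB) * B * (Real.exp (-a) / (1 - a)) + B0 * CR) + ρ₂) (L ^ (-a)) :=
  ne3Shape_of_slices_rpow F nρ (fun k V i => sliceKernel (G k V) (K k V) (D k V) i) N hL ha0 ha hδ
    (mul_nonneg hCBc (by nlinarith [mul_nonneg hCA hCP])) hA hℓ hd hzero hFN hN hcard
    (fun k V hV i _ x y => sliceKernel_bound_of_opData (G k V) (K k V) (D k V) (fun x y => (nρ k x y : ℝ))
      (by omega) (by linarith) hδ.le hCA hCBc hCP (fun x y => Nat.cast_nonneg _)
      (fun x z w y => by exact_mod_cast htri k x z w y) (hArow k V hV) (hPpt k V hV) (hBcol k V hV) i x y)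
    hdl h1 h3 h4 h5 hCJ hCB hCPo hCD hB hB0 hCR hΓ hΛr hρ₂ ht hosc hact hvol hread hresp hpair

end Junctions

/-! ## §6b  One level ASSEMBLED: the slice bound of King's (3.63) shape from the printed TYPE (3.42)/(3.49) by
name per level `j` (level-free constants), the two observation dictionaries, the block-averaging mass model and
nested-block geometry — and nothing else -/
section AssembledLevel

/-- The LEVEL-FREE row/column constant read off (3.42) items 0/1 through the block count:
`C_A = C_B = B₀·e^{δc}·A′·countConst(δ₀ − δ) p`. [folklore] -/
def printedCA (B₀ δ₀ δ c A' : ℝ) (p : ℕ) : ℝ :=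
  B₀ * Real.exp (δ * c) * (A' * countConst (δ₀ - δ) p)

/-- The LEVEL-FREE projection constant of (P_j), mass part + gauge part:
`C_P = a(L^{d+2} + 1)e^{δc} + C₃(L^{d+2} + 1)e^{(δ₁/2)c}`. [folklore] -/
def printedCP (a C₃ δ₁ δ L c : ℝ) (d : ℕ) : ℝ :=
  a * (L ^ (d + 2) + 1) * Real.exp (δ * c) + C₃ * (L ^ (d + 2) + 1) * Real.exp (δ₁ / 2 * c)

/-- `C_A ≥ 0` for `B₀, A′ ≥ 0`, `δ < δ₀`. [folklore] -/
theorem printedCA_nonneg {B₀ δ₀ δ c A' : ℝ} {p : ℕ} (hB₀ : 0 ≤ B₀) (hA' : 0 ≤ A') (hδ₀ : δ < δ₀) :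
    0 ≤ printedCA B₀ δ₀ δ c A' p :=
  mul_nonneg (mul_nonneg hB₀ (Real.exp_nonneg _))
    (mul_nonneg hA' (countConst_pos (by linarith) p).le)

/-- `C_P ≥ 0` for `a, C₃ ≥ 0`, `L ≥ 1`. [folklore] -/
theorem printedCP_nonneg {a C₃ δ₁ δ L c : ℝ} {d : ℕ} (ha : 0 ≤ a) (hC₃ : 0 ≤ C₃) (hL : 1 ≤ L) :
    0 ≤ printedCP a C₃ δ₁ δ L c d := by
  unfold printedCP
  have : 0 ≤ L ^ (d + 2) + 1 := by positivity
  positivity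

/-- **(P_j), mass part, level-dependent masses** `a_j, a_{j+1} ∈ [0, a]` (Bałaban's `a_k` varies with the level):
the same bound `a(L^{d+2} + 1)e^{δc}/(L^{j+1})^{d+2}` as `massDiff_weighted_scaled`. [folklore] -/
theorem massDiff_weighted_scaled' {X B B' : Type*} [DecidableEq B] [DecidableEq B'] (blk : X → B)
    (blk' : X → B') (τ τ' : X → X → ℝ) (ρ : X → X → ℝ) {a aj aj' δ L c : ℝ} {d : ℕ} (j : ℕ)
    (haj : 0 ≤ aj) (haj_le : aj ≤ a) (haj' : 0 ≤ aj') (haj'_le : aj' ≤ a) (hL : 1 ≤ L)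
    (hτ : ∀ z w, |τ z w| ≤ 1) (hτ' : ∀ z w, |τ' z w| ≤ 1) (hnest : ∀ z w, blk z = blk w → blk' z = blk' w)
    (hδ : 0 ≤ δ) (hdiam : ∀ z w, blk' z = blk' w → ρ z w ≤ c * L ^ (j + 1)) :
    ∀ z w, |(massKernel blk τ (aj / (L ^ j) ^ (d + 2))
        - massKernel blk' τ' (aj' / (L ^ (j + 1)) ^ (d + 2))) z w| * Real.exp (δ * (ρ z w / L ^ (j + 1)))
      ≤ a * (L ^ (d + 2) + 1) * Real.exp (δ * c) / (L ^ (j + 1)) ^ (d + 2) := by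
  intro z w
  have hL0 : 0 < L := by linarith
  have hs : 0 < L ^ (j + 1) := pow_pos hL0 _
  have ht : 0 < L ^ j := pow_pos hL0 _
  have htd : 0 < (L ^ j) ^ (d + 2) := pow_pos ht _
  have hsd : 0 < (L ^ (j + 1)) ^ (d + 2) := pow_pos hs _
  have h := massDiff_weighted blk blk' τ τ' ρ (div_nonneg haj htd.le) (div_nonneg haj' hsd.le) hτ hτ' hnest
    hδ hs hdiam z w
  refine h.trans ?_
  have hm : a * L ^ (d + 2) / (L ^ (j + 1)) ^ (d + 2) = a / (L ^ j) ^ (d + 2) := by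
    rw [div_eq_div_iff hsd.ne' htd.ne']
    ring
  have h1 : aj / (L ^ j) ^ (d + 2) ≤ a * L ^ (d + 2) / (L ^ (j + 1)) ^ (d + 2) := by
    rw [hm]
    exact div_le_div_of_nonneg_right haj_le htd.le
  have h2 : aj' / (L ^ (j + 1)) ^ (d + 2) ≤ a / (L ^ (j + 1)) ^ (d + 2) :=
    div_le_div_of_nonneg_right haj'_le hsd.le
  calc (aj / (L ^ j) ^ (d + 2) + aj' / (L ^ (j + 1)) ^ (d + 2)) * Real.exp (δ * c)
      ≤ (a * L ^ (d + 2) / (L ^ (j + 1)) ^ (d + 2) + a / (L ^ (j + 1)) ^ (d + 2)) * Real.exp (δ * c) :=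
        mul_le_mul_of_nonneg_right (add_le_add h1 h2) (Real.exp_nonneg _)
    _ = _ := by ring

/-- **THE PER-LEVEL SLICE BOUND FROM PRINTED TYPE + DICTIONARIES + GEOMETRY.** On one fine lattice `X` (one
renormalisation level `k`, suppressed), with level-`j` block geometries `g j` (cube maps `cube j`, cube length
`≡ L^j`, integer block distances `nbd j ≤ d_j`, fine distance `ρ ≤ L^j·nbd j + c·L^j` and symmetric, shell counts
`≤ A′(r+1)^p`, nested cubes, coarse cubes of `ρ`-diameter `≤ c·L^{j+1}`), the ONLY analytic inputs are, per level
`j` and with LEVEL-FREE constants, the tree's typed (3.42) `B9.Ineq342_346_347 (Gp j) B₀ δ₀ (U j)` and (3.49)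
`B9.Ineq349 d (P j) C₃ δ₁ (U j)` — HYPOTHESES of printed type (B9 Thm 3.1 / 3.3 read for the level-`j` auxiliary
propagators of the resolvent telescoping, reading (I′); never asserted here) — observed through the dictionaries
`RowObservedBy` (item 0: the rows of `G j`; item 1: the rows of `(G j·D)ᵀ`, i.e. `∇_UG⁽ʲ⁾` for Hermitian `G`
[model]) and `EntryDominated` (item 3: the gauge-fixing kernels `Ng j`), and the operator model
`K j = massKernel (cube j) (τ j) (a_j/(L^j)^{d+2}) + Ng j` (`|τ j| ≤ 1`, `0 ≤ a_j ≤ a`). CONCLUSION: every slice of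
`sliceKernel G K D` obeys King's (3.63) shape `C_A(1 + C_A·C_P)·e^{−δρ(x,y)/L^i}/(L^i)^{d−1}` with the level-free
`C_A = printedCA B₀ δ₀ δ c A′ p`, `C_P = printedCP a C₃ δ₁ δ L c d` — i.e. the binder `hg` of
`T4SliceTelescoping.consistencyT2_of_slices` at this level. HONEST: nothing of Bałaban is constructed; what a
successor supplies is the geometry instance and the two dictionaries for the real objects. [folklore] -/
theorem sliceKernel_bound_of_printedType {X : Type*} [Fintype X] (g : ℕ → B9.Geometry)
    (Bg : ℕ → B9.Backgrounds) [∀ j, Fintype (g j).Site] [∀ j, DecidableEq (g j).Site]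
    (Gp : ∀ j, B9.KernelFamily (g j) (Bg j)) (P : ∀ j, B9.FineKernel (g j) (Bg j)) (U : ∀ j, (Bg j).Cfg)
    (cube : ∀ j, X → (g j).Site) (nbd : ∀ j, (g j).Site → (g j).Site → ℕ)
    (G Ng K : ℕ → Matrix X X ℝ) (D : Matrix X X ℝ) (τ : ℕ → X → X → ℝ) (am : ℕ → ℝ) (ρ : X → X → ℝ)
    {B₀ δ₀ C₃ δ₁ δ L c A' a : ℝ} {p d : ℕ}
    (hd : 1 ≤ d) (hL : 1 ≤ L) (hB₀ : 0 ≤ B₀) (hC₃ : 0 ≤ C₃) (hδ : 0 ≤ δ) (hδ₀ : δ < δ₀) (hδ₁ : δ ≤ δ₁ / 2)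
    (hA' : 0 ≤ A') (ha : 0 ≤ a)
    (hρ0 : ∀ x y, 0 ≤ ρ x y) (hρsymm : ∀ x y, ρ x y = ρ y x)
    (htri : ∀ x z w y, ρ x y ≤ ρ x z + ρ z w + ρ w y)
    (hlen : ∀ j (y : (g j).Site), (g j).len y = L ^ j)
    (hbd : ∀ j (y y₁ : (g j).Site), (nbd j y y₁ : ℝ) ≤ (g j).dist y y₁)
    (hρbd : ∀ j x z, ρ x z ≤ L ^ j * nbd j (cube j x) (cube j z) + c * L ^ j)
    (hcount : ∀ j (b₀ : (g j).Site) (r : ℕ),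
      ((Finset.univ.filter fun b => nbd j b₀ b = r).card : ℝ) ≤ A' * ((r : ℝ) + 1) ^ p)
    (hnest : ∀ j z w, cube j z = cube j w → cube (j + 1) z = cube (j + 1) w)
    (hdiam : ∀ j z w, cube (j + 1) z = cube (j + 1) w → ρ z w ≤ c * L ^ (j + 1))
    (h342 : ∀ j, B9.Ineq342_346_347 (Gp j) B₀ δ₀ (U j)) (h349 : ∀ j, B9.Ineq349 d (P j) C₃ δ₁ (U j))
    (hobsA : ∀ j, RowObservedBy (Gp j) (U j) 0 (G j) (cube j))
    (hobsB : ∀ j, RowObservedBy (Gp j) (U j) 1 (G j * D).transpose (cube j))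
    (hdom : ∀ j, EntryDominated (P j) (U j) 3 (Ng j) (cube j))
    (hτ : ∀ j z w, |τ j z w| ≤ 1) (ham : ∀ j, 0 ≤ am j ∧ am j ≤ a)
    (hK : ∀ j, K j = massKernel (cube j) (τ j) (am j / (L ^ j) ^ (d + 2)) + Ng j) :
    ∀ i x y, |sliceKernel G K D i x y|
      ≤ printedCA B₀ δ₀ δ c A' p * (1 + printedCA B₀ δ₀ δ c A' p * printedCP a C₃ δ₁ δ L c d)
        * (Real.exp (-(δ * (ρ x y / L ^ i))) / (L ^ i) ^ (d - 1)) := by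
  have hL0 : 0 < L := by linarith
  have hlen0 : ∀ j (y : (g j).Site), 0 ≤ (g j).len y := fun j y => by rw [hlen j y]; exact (pow_pos hL0 j).le
  have hlens : ∀ j (y : (g j).Site), (g j).len y ≤ L ^ j := fun j y => (hlen j y).le
  -- (A_j): rows of G j from (3.42) item 0
  have hA : ∀ j x, ∑ z, |G j x z| * Real.exp (δ * (ρ x z / L ^ j))
      ≤ printedCA B₀ δ₀ δ c A' p * (L ^ j) ^ 2 := fun j =>
    opDataA_of_342 (Gp j) (U j) j hB₀ hδ hδ₀ hL hA' (hlen0 j) (hlens j) (h342 j) (G j) (cube j) (hobsA j)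
      (nbd j) (hbd j) ρ (hρbd j) (hcount j)
  -- (B_j): columns of G j * D from (3.42) item 1 on the transpose
  have hB : ∀ j y, ∑ w, |(G j * D) w y| * Real.exp (δ * (ρ w y / L ^ j))
      ≤ printedCA B₀ δ₀ δ c A' p * L ^ j := fun j =>
    opDataB_of_342 (Gp j) (U j) j hB₀ hδ hδ₀ hL hA' (hlen0 j) (hlens j) (h342 j) (G j * D) (cube j) (hobsB j)
      (nbd j) (hbd j) ρ (fun w y => by rw [hρsymm]; exact hρbd j y w) (hcount j)
  -- (P_j): mass part (model, proved) + gauge part ((3.49) by name at levels j, j+1)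
  have hdist : ∀ j z w, ρ z w ≤ L ^ j * (g j).dist (cube j z) (cube j w) + c * L ^ j := by
    intro j z w
    have h1 := hρbd j z w
    have h2 := hbd j (cube j z) (cube j w)
    nlinarith [pow_pos hL0 j]
  have hPm : ∀ j z w, |(massKernel (cube j) (τ j) (am j / (L ^ j) ^ (d + 2))
      - massKernel (cube (j + 1)) (τ (j + 1)) (am (j + 1) / (L ^ (j + 1)) ^ (d + 2))) z w|
        * Real.exp (δ * (ρ z w / L ^ (j + 1)))
      ≤ a * (L ^ (d + 2) + 1) * Real.exp (δ * c) / (L ^ (j + 1)) ^ (d + 2) := fun j =>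
    massDiff_weighted_scaled' (cube j) (cube (j + 1)) (τ j) (τ (j + 1)) ρ j (ham j).1 (ham j).2
      (ham (j + 1)).1 (ham (j + 1)).2 hL (hτ j) (hτ (j + 1)) (hnest j) hδ (hdiam j)
  have hPg : ∀ j z w, |(Ng j - Ng (j + 1)) z w| * Real.exp (δ * (ρ z w / L ^ (j + 1)))
      ≤ C₃ * (L ^ (d + 2) + 1) * Real.exp (δ₁ / 2 * c) / (L ^ (j + 1)) ^ (d + 2) := fun j =>
    gaugeDiff_weighted_scaled (P j) (U j) (P (j + 1)) (U (j + 1)) j hL hC₃ hδ hδ₁ (hlen j) (hlen (j + 1))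
      (h349 j) (h349 (j + 1)) (Ng j) (Ng (j + 1)) (cube j) (cube (j + 1)) (hdom j) (hdom (j + 1)) ρ hρ0
      (hdist j) (hdist (j + 1))
  have hP : ∀ j z w, |(K j - K (j + 1)) z w| * Real.exp (δ * (ρ z w / L ^ (j + 1)))
      ≤ printedCP a C₃ δ₁ δ L c d / (L ^ (j + 1)) ^ (d + 2) := by
    intro j z w
    rw [hK j, hK (j + 1)]
    have h := opDataP_of_parts _ _ _ _ (fun z w => Real.exp (δ * (ρ z w / L ^ (j + 1))))
      (fun _ _ => Real.exp_nonneg _) (hPm j) (hPg j) z w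
    refine h.trans (le_of_eq ?_)
    unfold printedCP
    ring
  exact sliceKernel_bound_of_opData G K D ρ hd hL hδ (printedCA_nonneg hB₀ hA' hδ₀)
    (printedCA_nonneg hB₀ hA' hδ₀) (printedCP_nonneg ha hC₃ hL) hρ0 htri hA hP hB

end AssembledLevel

/-! ## §7  Examples (the definitions compute; the pipeline closes on explicit data) -/
section Examples

/-- The mass kernel on `Fin 4` with blocks `{0,1}`, `{2,3}` (`blk x = x/2`), unit transporters, mass `3`: an
in-block entry is `3`, a cross-block entry is `0`. -/
example : massKernel (fun x : Fin 4 => x.val / 2) (fun _ _ => (1 : ℝ)) 3 ⟨0, by omega⟩ ⟨1, by omega⟩ = 3 := by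
  simp [massKernel]

example : massKernel (fun x : Fin 4 => x.val / 2) (fun _ _ => (1 : ℝ)) 3 ⟨1, by omega⟩ ⟨2, by omega⟩ = 0 := by
  simp [massKernel]

/-- Scale transport of a weight: `e^{δr/4} ≤ e^{δr/2}` for `δ, r ≥ 0`. -/
example {δ r : ℝ} (hδ : 0 ≤ δ) (hr : 0 ≤ r) : Real.exp (δ * (r / 4)) ≤ Real.exp (δ * (r / 2)) :=
  weight_mono_scale hδ hr (by norm_num) (by norm_num)

end Examples


end Literature.MathematicalPhysics.QuantumFieldTheory.Balaban1983to89.T4SliceOperatorData
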